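import Literature.Analysis.FluidPDE.HeatCommutator
import Literature.Analysis.FluidPDE.OnsagerBDSVPotentialTheoryProofs
import Literature.Analysis.FluidPDE.OnsagerBDSVSchauderHigher
import Literature.Analysis.FunctionSpaces.HolderScaleInterpolation
import HarnessLib

/-!
# The commutator `[∂ᵢ∂ⱼΔ⁻¹, b·∇]` on `C^α(T³)`: the case `N = 0` of BDSV App. D, Prop. D.1

Buckmaster–De Lellis–Székelyhidi–Vicol, *Onsager's conjecture for admissible weak solutions*,
CPAM 72 (2019) = arXiv:1701.08678, App. D, Prop. D.1 (after Constantin 2015, Lemma 1): for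
`α ∈ (0,1)`, a Calderón–Zygmund operator `T_K` and a vector field `b`,
`‖[T_K, b·∇]f‖_α ≲ ‖b‖_{1+α} ‖f‖_α`. The named fact `BDSV.commutatorCZBound`
(`OnsagerBDSVPotentialTheory`) transcribes it (all `N`) for `T = ∂ᵢ∂ⱼΔ⁻¹ = BDSV.rieszHessian i j`.
This file proves the case `N = 0` (`BDSV.commutator_rieszHessian_zero_le`); the induction on `N`
(Leibniz and interpolation, as printed) and the discharge are in `OnsagerBDSVCommutatorProofs`.

## Proof (heat semigroup instead of singular integrals)

The printed proof of the case `N = 0` is Constantin's kernel computation. Here, as for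
`BDSV.holderCZBound` (`TorusHeatHolder`, `OnsagerBDSVPotentialTheoryProofs`), the flat-torus
Calderón–Zygmund theory is replaced by the Gauss–Weierstrass semigroup `e^{σΔ}` on the periodic
lifts: every `TF`, `F` smooth, satisfies `Δ(TF) = ∂ᵢ∂ⱼF`, hence
`(TF)~ = e^{Δ}(TF)~ - ∫₀¹ ∂ᵢ∂ⱼe^{σΔ}F̃ dσ` (`TorusHeat.lift_eq_heatExtension_one_sub_integral`).
Writing `b·∇f = ∑ₖ (∂ₖ(bₖf) - (∂ₖbₖ)f)` and `∂ₖT = T∂ₖ`,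
`[T, b·∇]f = ∑ₖ ∂ₖT(bₖf) - T((div b)f) - ∑ₖ bₖ ∂ₖ(Tf)`, so that
`([T,b·∇]f)~ = FAR - ∫₀¹ Φ_σ dσ` with the far field
`FAR = ∑ₖ e^{Δ}(∂ₖT(bₖf))~ - e^{Δ}(T((div b)f))~ - ∑ₖ b̃ₖ e^{Δ}(∂ₖTf)~` (bounded and Lipschitz by
`sup|T·|` and the smoothing bounds at time one) and the near field
`Φ_σ = ∑ₖ [∂ᵢ∂ⱼ∂ₖe^{σΔ}(bₖf)~ - b̃ₖ ∂ᵢ∂ⱼ∂ₖe^{σΔ}f̃] - ∂ᵢ∂ⱼe^{σΔ}((div b)f)~`, a sum of third-order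
heat commutators with the multipliers `bₖ` (`TorusHeat.norm_heatComm₃_le_rpow`,
`…_sub_le_rpow`: `|Φ_σ| ≲ σ^{α/2-1}`, `Lip(Φ_σ) ≲ σ^{(α-3)/2}`, constants
`≲ ‖b‖_{1,α}‖f‖_{0,α}`) and a second-order smoothing of `C^α` data; the near-field calculus of
`TorusHeatHolder` (`norm_integral_Ioc_sub_le_of_bounds`) then gives the `C^α` bound.

## Main statements (all proved)

* `TorusHeat.exists_commutator_holder_bound`: the abstract real form on `T^d` (data `U = Tf`,
  `Wₖ = T(bₖf)`, `W₀ = T((div b)f)` entering only through `Δ∂ₖU = ∂ᵢ∂ⱼ∂ₖf`,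
  `Δ∂ₖWₖ = ∂ᵢ∂ⱼ∂ₖ(bₖf)`, `ΔW₀ = ∂ᵢ∂ⱼ((div b)f)` and sup bounds);
* `BDSV.rieszHessian_convect_sub_convect_rieszHessian_eq`: the algebraic rearrangement of
  `[T, b·∇]f` on `T³`;
* `BDSV.commutator_rieszHessian_zero_le`: for `0 < α < 1` there is `C` with
  `‖T(b·∇f) - b·∇(Tf)‖_{C^{0,α}} ≤ C ‖b‖_{C^{1,α}} ‖f‖_{C^{0,α}}` for all `i j` and smooth `b, f`.

## References

* T. Buckmaster, C. De Lellis, L. Székelyhidi Jr., V. Vicol, *Onsager's conjecture for admissible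
  weak solutions*, Comm. Pure Appl. Math. 72 (2019) 229–274 = arXiv:1701.08678, App. D,
  Prop. D.1; App. C, Prop. C.1. [`BuckmasterEtAl2018`]
* P. Constantin, *Lagrangian–Eulerian methods for uniqueness in hydrodynamic systems*, Adv. Math.
  278 (2015) 67–102, Lemma 1.
* A. Lunardi, *Analytic Semigroups and Optimal Regularity in Parabolic Problems* (1995), §3.1.
-/

noncomputable section

open MeasureTheory Set Filter Topology InnerProductSpace
open Literature.Analysis.UnboundedOperators
open scoped Real ENNReal NNReal Laplacian ContDiff

namespace Literature.Analysis.FluidPDE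

namespace TorusHeat

section FarField

variable {d : Type*} [Fintype d]
variable {F : Type*} [NormedAddCommGroup F] [NormedSpace ℝ F] [CompleteSpace F]

/-- **The far field of zeroth-order data is Lipschitz**: for a smooth torus function `ψ` with
`‖ψ‖ ≤ B`, `‖e^{1·Δ}ψ̃(x) - e^{1·Δ}ψ̃(y)‖ ≤ 2^{n/2} B ‖x - y‖`. [cite: GigaGigaSaal2010, §1.1.3] -/
theorem norm_heatExtension_one_lift_sub_le {ψ : UnitAddTorus d → F}
    (hψ : FunctionSpaces.Torus.IsSmooth ψ) {B : ℝ} (hB : ∀ z, ‖ψ z‖ ≤ B) (x y : EuclideanSpace ℝ d) :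
    ‖heatExtension (FunctionSpaces.Torus.lift ψ) 1 x - heatExtension (FunctionSpaces.Torus.lift ψ) 1 y‖ ≤
      (2 : ℝ) ^ ((Module.finrank ℝ (EuclideanSpace ℝ d) : ℝ) / 2) * B * ‖x - y‖ := by
  set P : EuclideanSpace ℝ d → F := heatExtension (FunctionSpaces.Torus.lift ψ) 1 with hP
  have hPd : ∀ z, DifferentiableAt ℝ P z := fun z =>
    ((contDiff_heatExtension_lift hψ.continuous one_pos (m := 1)).differentiable one_ne_zero) z
  have hB0 : 0 ≤ B := (norm_nonneg _).trans (hB 0)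
  have hbound : ∀ z, ‖fderiv ℝ P z‖ ≤ (2 : ℝ) ^ ((Module.finrank ℝ (EuclideanSpace ℝ d) : ℝ) / 2) * B := by
    intro z
    refine ContinuousLinearMap.opNorm_le_bound _ (by positivity) fun v => ?_
    rw [hP, fderiv_heatExtension_lift_apply hψ one_pos z v]
    have h := norm_heatExtension_lift_lineDeriv_le_of_bound hψ hB one_pos z v
    rwa [Real.one_rpow, mul_one] at h
  exact Convex.norm_image_sub_le_of_norm_fderiv_le (fun z _ => hPd z) (fun z _ => hbound z)
    convex_univ (mem_univ y) (mem_univ x)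

/-- **The far field of first-order data is bounded**: `‖e^{1·Δ}(∂ᵥψ)~(x)‖ ≤ 2^{n/2} B ‖v‖` for a
smooth torus function `ψ` with `‖ψ‖ ≤ B`. [cite: GigaGigaSaal2010, §1.1.3] -/
theorem norm_heatExtension_one_lift_lineDeriv_le {ψ : UnitAddTorus d → F}
    (hψ : FunctionSpaces.Torus.IsSmooth ψ) {B : ℝ} (hB : ∀ z, ‖ψ z‖ ≤ B) (x v : EuclideanSpace ℝ d) :
    ‖heatExtension (FunctionSpaces.Torus.lift (fun z => FunctionSpaces.Torus.lineDeriv ψ z v)) 1 x‖ ≤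
      (2 : ℝ) ^ ((Module.finrank ℝ (EuclideanSpace ℝ d) : ℝ) / 2) * B * ‖v‖ := by
  have h := norm_heatExtension_lift_lineDeriv_le_of_bound hψ hB one_pos x v
  rwa [Real.one_rpow, mul_one] at h

/-- **The far field of first-order data is Lipschitz**:
`‖e^{1·Δ}(∂ᵥψ)~(x) - e^{1·Δ}(∂ᵥψ)~(y)‖ ≤ 2 (2^{n/2})² B ‖v‖ ‖x - y‖` for a smooth torus function
`ψ` with `‖ψ‖ ≤ B` (second-order smoothing bound at time `1 = ½ + ½`). [cite: GigaGigaSaal2010, §1.1.3] -/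
theorem norm_heatExtension_one_lift_lineDeriv_sub_le {ψ : UnitAddTorus d → F}
    (hψ : FunctionSpaces.Torus.IsSmooth ψ) {B : ℝ} (hB : ∀ z, ‖ψ z‖ ≤ B) (v x y : EuclideanSpace ℝ d) :
    ‖heatExtension (FunctionSpaces.Torus.lift (fun z => FunctionSpaces.Torus.lineDeriv ψ z v)) 1 x -
        heatExtension (FunctionSpaces.Torus.lift (fun z => FunctionSpaces.Torus.lineDeriv ψ z v)) 1 y‖ ≤
      2 * ((2 : ℝ) ^ ((Module.finrank ℝ (EuclideanSpace ℝ d) : ℝ) / 2)) ^ 2 * B * ‖v‖ * ‖x - y‖ := by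
  have hψv : FunctionSpaces.Torus.IsSmooth (fun z => FunctionSpaces.Torus.lineDeriv ψ z v) := hψ.lineDeriv v
  set P : EuclideanSpace ℝ d → F :=
    heatExtension (FunctionSpaces.Torus.lift (fun z => FunctionSpaces.Torus.lineDeriv ψ z v)) 1 with hP
  have hPd : ∀ z, DifferentiableAt ℝ P z := fun z =>
    ((contDiff_heatExtension_lift hψv.continuous one_pos (m := 1)).differentiable one_ne_zero) z
  have hB0 : 0 ≤ B := (norm_nonneg _).trans (hB 0)
  have hbound : ∀ z, ‖fderiv ℝ P z‖ ≤
      2 * ((2 : ℝ) ^ ((Module.finrank ℝ (EuclideanSpace ℝ d) : ℝ) / 2)) ^ 2 * B * ‖v‖ := by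
    intro z
    refine ContinuousLinearMap.opNorm_le_bound _ (by positivity) fun w => ?_
    rw [hP, fderiv_heatExtension_lift_apply hψv one_pos z w]
    have h := norm_heatExtension_one_lift_lineDeriv₂_le hψ hB z w v
    refine h.trans_eq ?_
    ring
  exact Convex.norm_image_sub_le_of_norm_fderiv_le (fun z _ => hPd z) (fun z _ => hbound z)
    convex_univ (mem_univ y) (mem_univ x)

omit [CompleteSpace F] in
/-- The lift of a smooth torus function is `r`-Hölder for every `0 ≤ r ≤ 1` (it is bounded and
Lipschitz). [folklore] -/
theorem exists_norm_lift_sub_lift_le_rpow {ψ : UnitAddTorus d → F} (hψ : FunctionSpaces.Torus.IsSmooth ψ)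
    {r : ℝ} (hr0 : 0 ≤ r) (hr1 : r ≤ 1) :
    ∃ A : ℝ, 0 ≤ A ∧ ∀ y z,
      ‖FunctionSpaces.Torus.lift ψ y - FunctionSpaces.Torus.lift ψ z‖ ≤ A * ‖y - z‖ ^ r := by
  obtain ⟨C, hC0, hC⟩ := exists_norm_lift_le hψ.continuous
  obtain ⟨L, hL0, hL⟩ := exists_norm_fderiv_lift_le hψ
  refine ⟨L + 2 * C, by positivity, fun y z => ?_⟩
  have hlip := norm_lift_sub_lift_le_of_fderiv_le hψ hL y z
  set h : ℝ := ‖y - z‖ with hh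
  have hh0 : 0 ≤ h := norm_nonneg _
  rcases le_or_gt h 1 with hle | hgt
  · have hhr : h ≤ h ^ r := by
      rcases hh0.eq_or_lt with h0 | hpos
      · rw [← h0]
        rcases hr0.eq_or_lt with hr | hr
        · rw [← hr, Real.rpow_zero]; exact zero_le_one
        · rw [Real.zero_rpow hr.ne']
      · exact Real.self_le_rpow_of_le_one hh0 hle hr1
    calc ‖FunctionSpaces.Torus.lift ψ y - FunctionSpaces.Torus.lift ψ z‖ ≤ L * h := hlip
      _ ≤ L * h ^ r := mul_le_mul_of_nonneg_left hhr hL0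
      _ ≤ (L + 2 * C) * h ^ r := by
          have : 0 ≤ h ^ r := Real.rpow_nonneg hh0 r
          nlinarith
  · have h1 : 1 ≤ h ^ r := Real.one_le_rpow hgt.le hr0
    calc ‖FunctionSpaces.Torus.lift ψ y - FunctionSpaces.Torus.lift ψ z‖
        ≤ ‖FunctionSpaces.Torus.lift ψ y‖ + ‖FunctionSpaces.Torus.lift ψ z‖ := norm_sub_le _ _
      _ ≤ C + C := add_le_add (hC y) (hC z)
      _ = (2 * C) * 1 := by ring
      _ ≤ (L + 2 * C) * h ^ r := mul_le_mul (by linarith) h1 zero_le_one (by positivity)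

/-- For a smooth torus function `φ`, `σ ↦ e^{σΔ}(∂₁∂₂φ)~(x)` is integrable on `(0, 1]`
(`‖e^{σΔ}(∂₁∂₂φ)~‖ ≲ σ^{-3/4}` from the `½`-Hölder bound of `φ̃`). [folklore] -/
theorem integrableOn_heatExtension_lift_lineDeriv₂ {φ : UnitAddTorus d → F}
    (hφ : FunctionSpaces.Torus.IsSmooth φ) (v₁ v₂ x : EuclideanSpace ℝ d) :
    IntegrableOn (fun σ => heatExtension (FunctionSpaces.Torus.lift (fun z => FunctionSpaces.Torus.lineDeriv
      (fun z' => FunctionSpaces.Torus.lineDeriv φ z' v₂) z v₁)) σ x) (Ioc 0 1) := by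
  obtain ⟨A, hA0, hA⟩ := exists_norm_lift_sub_lift_le_rpow hφ (r := 1 / 2) (by norm_num) (by norm_num)
  have hf₂ : FunctionSpaces.Torus.IsSmooth (fun z => FunctionSpaces.Torus.lineDeriv
      (fun z' => FunctionSpaces.Torus.lineDeriv φ z' v₂) z v₁) := (hφ.lineDeriv v₂).lineDeriv v₁
  have hc : ContinuousOn (fun σ => heatExtension (FunctionSpaces.Torus.lift (fun z => FunctionSpaces.Torus.lineDeriv
      (fun z' => FunctionSpaces.Torus.lineDeriv φ z' v₂) z v₁)) σ x) (Ioi 0) :=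
    continuousOn_heatExtension_time (memLp_top_lift hf₂.continuous) le_top x
  refine (norm_integral_Ioc_le_of_norm_le_rpow hc
    (K := 2 * ((2 : ℝ) ^ ((Module.finrank ℝ (EuclideanSpace ℝ d) : ℝ) / 2)) ^ 2 *
      (1 + 2 * (2 : ℝ) ^ ((Module.finrank ℝ (EuclideanSpace ℝ d) : ℝ) / 2)) * A * ‖v₁‖ * ‖v₂‖)
    (γ := (1 / 2 : ℝ) / 2) (by norm_num) fun σ hσ => ?_).1
  exact norm_heatExtension_lift_lineDeriv₂_le_rpow hφ hA0 (by norm_num) (by norm_num) hA hσ.1 x v₁ v₂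

end FarField

/-! ## The commutator estimate in real form -/

section Commutator

variable {F : Type*} [NormedAddCommGroup F] [NormedSpace ℝ F] [CompleteSpace F]

/-- **The near field.** Fix `0 < r < 1`. There are `K₀, L₀ ≥ 0` (depending on `d, r`) such
that for smooth `bₖ` (`k : d`), `f` on `T^d`, coordinates `i, j` and real bounds
`‖Db̃ₖ‖, [Db̃ₖ]_r ≤ 𝔟`, `‖f‖, [f̃]_r ≤ 𝔣`, the near-field family
`Φ_σ = ∑ₖ [e^{σΔ}(∂ᵢ∂ⱼ∂ₖ(bₖf))~ - b̃ₖ e^{σΔ}(∂ᵢ∂ⱼ∂ₖf)~] - e^{σΔ}(∂ᵢ∂ⱼ((∑ₖ∂ₖbₖ)f))~` is integrable on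
`(0,1]` with `‖∫₀¹ Φ_σ(x) dσ‖ ≤ K₀ 𝔟𝔣` and `‖∫₀¹ Φ_σ(x) - ∫₀¹ Φ_σ(y)‖ ≤ L₀ 𝔟𝔣 ‖x - y‖^r`
(`norm_heatComm₃_le_rpow`, `…_sub_le_rpow`, the second-order smoothing bounds for the `r`-Hölder
function `(div b)f`, and `norm_integral_Ioc_sub_le_of_bounds`). [folklore] -/
theorem exists_commutator_nearField_bound (d : Type*) [Fintype d] [DecidableEq d] {r : ℝ}
    (hr0 : 0 < r) (hr1 : r < 1) :
    ∃ K₀ L₀ : ℝ, 0 ≤ K₀ ∧ 0 ≤ L₀ ∧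
      ∀ {b : d → UnitAddTorus d → ℝ} {f : UnitAddTorus d → F}
        (_hb : ∀ k, FunctionSpaces.Torus.IsSmooth (b k)) (_hf : FunctionSpaces.Torus.IsSmooth f) (i j : d)
        {𝔟 𝔣 : ℝ} (_h𝔟 : 0 ≤ 𝔟) (_hL : ∀ k y, ‖fderiv ℝ (FunctionSpaces.Torus.lift (b k)) y‖ ≤ 𝔟)
        (_hH : ∀ k a a', ‖fderiv ℝ (FunctionSpaces.Torus.lift (b k)) a -
          fderiv ℝ (FunctionSpaces.Torus.lift (b k)) a'‖ ≤ 𝔟 * ‖a - a'‖ ^ r)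
        (_hM : ∀ z, ‖f z‖ ≤ 𝔣)
        (_hA : ∀ y z, ‖FunctionSpaces.Torus.lift f y - FunctionSpaces.Torus.lift f z‖ ≤ 𝔣 * ‖y - z‖ ^ r),
        (∀ x, IntegrableOn (fun σ => (∑ k, (heatExtension (FunctionSpaces.Torus.lift (fun z =>
              FunctionSpaces.Torus.lineDeriv (fun z' => FunctionSpaces.Torus.lineDeriv (fun z'' =>
                FunctionSpaces.Torus.lineDeriv (fun w => b k w • f w) z'' (EuclideanSpace.single k (1 : ℝ)))
                z' (EuclideanSpace.single j (1 : ℝ))) z (EuclideanSpace.single i (1 : ℝ)))) σ x -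
            FunctionSpaces.Torus.lift (b k) x • heatExtension (FunctionSpaces.Torus.lift (fun z =>
              FunctionSpaces.Torus.lineDeriv (fun z' => FunctionSpaces.Torus.lineDeriv (fun z'' =>
                FunctionSpaces.Torus.lineDeriv f z'' (EuclideanSpace.single k (1 : ℝ)))
                z' (EuclideanSpace.single j (1 : ℝ))) z (EuclideanSpace.single i (1 : ℝ)))) σ x)) -
            heatExtension (FunctionSpaces.Torus.lift (fun z => FunctionSpaces.Torus.lineDeriv (fun z' =>
              FunctionSpaces.Torus.lineDeriv (fun w => (∑ k, FunctionSpaces.Torus.partialDeriv k (b k) w) • f w)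
                z' (EuclideanSpace.single j (1 : ℝ))) z (EuclideanSpace.single i (1 : ℝ)))) σ x) (Ioc 0 1) ∧
          ‖∫ σ in Ioc 0 1, ((∑ k, (heatExtension (FunctionSpaces.Torus.lift (fun z =>
              FunctionSpaces.Torus.lineDeriv (fun z' => FunctionSpaces.Torus.lineDeriv (fun z'' =>
                FunctionSpaces.Torus.lineDeriv (fun w => b k w • f w) z'' (EuclideanSpace.single k (1 : ℝ)))
                z' (EuclideanSpace.single j (1 : ℝ))) z (EuclideanSpace.single i (1 : ℝ)))) σ x -
            FunctionSpaces.Torus.lift (b k) x • heatExtension (FunctionSpaces.Torus.lift (fun z =>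
              FunctionSpaces.Torus.lineDeriv (fun z' => FunctionSpaces.Torus.lineDeriv (fun z'' =>
                FunctionSpaces.Torus.lineDeriv f z'' (EuclideanSpace.single k (1 : ℝ)))
                z' (EuclideanSpace.single j (1 : ℝ))) z (EuclideanSpace.single i (1 : ℝ)))) σ x)) -
            heatExtension (FunctionSpaces.Torus.lift (fun z => FunctionSpaces.Torus.lineDeriv (fun z' =>
              FunctionSpaces.Torus.lineDeriv (fun w => (∑ k, FunctionSpaces.Torus.partialDeriv k (b k) w) • f w)
                z' (EuclideanSpace.single j (1 : ℝ))) z (EuclideanSpace.single i (1 : ℝ)))) σ x)‖ ≤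
            K₀ * (𝔟 * 𝔣)) ∧
        (∀ x y, ‖(∫ σ in Ioc 0 1, ((∑ k, (heatExtension (FunctionSpaces.Torus.lift (fun z =>
              FunctionSpaces.Torus.lineDeriv (fun z' => FunctionSpaces.Torus.lineDeriv (fun z'' =>
                FunctionSpaces.Torus.lineDeriv (fun w => b k w • f w) z'' (EuclideanSpace.single k (1 : ℝ)))
                z' (EuclideanSpace.single j (1 : ℝ))) z (EuclideanSpace.single i (1 : ℝ)))) σ x -
            FunctionSpaces.Torus.lift (b k) x • heatExtension (FunctionSpaces.Torus.lift (fun z =>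
              FunctionSpaces.Torus.lineDeriv (fun z' => FunctionSpaces.Torus.lineDeriv (fun z'' =>
                FunctionSpaces.Torus.lineDeriv f z'' (EuclideanSpace.single k (1 : ℝ)))
                z' (EuclideanSpace.single j (1 : ℝ))) z (EuclideanSpace.single i (1 : ℝ)))) σ x)) -
            heatExtension (FunctionSpaces.Torus.lift (fun z => FunctionSpaces.Torus.lineDeriv (fun z' =>
              FunctionSpaces.Torus.lineDeriv (fun w => (∑ k, FunctionSpaces.Torus.partialDeriv k (b k) w) • f w)
                z' (EuclideanSpace.single j (1 : ℝ))) z (EuclideanSpace.single i (1 : ℝ)))) σ x)) -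
          ∫ σ in Ioc 0 1, ((∑ k, (heatExtension (FunctionSpaces.Torus.lift (fun z =>
              FunctionSpaces.Torus.lineDeriv (fun z' => FunctionSpaces.Torus.lineDeriv (fun z'' =>
                FunctionSpaces.Torus.lineDeriv (fun w => b k w • f w) z'' (EuclideanSpace.single k (1 : ℝ)))
                z' (EuclideanSpace.single j (1 : ℝ))) z (EuclideanSpace.single i (1 : ℝ)))) σ y -
            FunctionSpaces.Torus.lift (b k) y • heatExtension (FunctionSpaces.Torus.lift (fun z =>
              FunctionSpaces.Torus.lineDeriv (fun z' => FunctionSpaces.Torus.lineDeriv (fun z'' =>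
                FunctionSpaces.Torus.lineDeriv f z'' (EuclideanSpace.single k (1 : ℝ)))
                z' (EuclideanSpace.single j (1 : ℝ))) z (EuclideanSpace.single i (1 : ℝ)))) σ y)) -
            heatExtension (FunctionSpaces.Torus.lift (fun z => FunctionSpaces.Torus.lineDeriv (fun z' =>
              FunctionSpaces.Torus.lineDeriv (fun w => (∑ k, FunctionSpaces.Torus.partialDeriv k (b k) w) • f w)
                z' (EuclideanSpace.single j (1 : ℝ))) z (EuclideanSpace.single i (1 : ℝ)))) σ y)‖ ≤
            L₀ * (𝔟 * 𝔣) * ‖x - y‖ ^ r) := by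
  -- the constants
  set c : ℝ := (2 : ℝ) ^ ((Module.finrank ℝ (EuclideanSpace ℝ d) : ℝ) / 2) with hc
  set cH : ℝ := 1 + 2 * c with hcH
  set K₁ : ℝ := 2 * Real.sqrt 2 * c ^ 2 with hK₁
  set N : ℝ := (Fintype.card d : ℝ) with hN
  have hc0 : 0 < c := Real.rpow_pos_of_pos two_pos _
  have hcH0 : 0 < cH := by rw [hcH]; positivity
  have hK₁0 : 0 ≤ K₁ := by rw [hK₁]; positivity
  have hN0 : 0 ≤ N := Nat.cast_nonneg _
  have h1r : 0 < 1 - r := by linarith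
  set KC3 : ℝ := 3 * ((2 : ℝ) ^ (r / 2) / (3 : ℝ) ^ (r / 2)) * c ^ 2 * cH * K₁ with hKC3
  set K2 : ℝ := 2 * c ^ 2 * cH with hK2
  set KC4 : ℝ := 8 * ((2 : ℝ) ^ (r / 2) / (4 : ℝ) ^ (r / 2)) * c ^ 3 * cH * K₁ with hKC4
  set KC3L : ℝ := ((2 : ℝ) ^ (r / 2) / (3 : ℝ) ^ (r / 2) * (3 : ℝ) ^ ((3 : ℝ) / 2)) * c ^ 3 * cH with hKC3L
  set K3 : ℝ := (3 : ℝ) ^ ((3 : ℝ) / 2) * c ^ 3 * cH * ((2 : ℝ) ^ (r / 2) / (3 : ℝ) ^ (r / 2)) with hK3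
  set KΦ : ℝ := N * (4 * KC3) + K2 * (2 * N) with hKΦ
  set LΦ : ℝ := N * (5 * KC4 + KC3L) + K3 * (2 * N) with hLΦ
  have hKC30 : 0 ≤ KC3 := by rw [hKC3]; positivity
  have hK20 : 0 ≤ K2 := by rw [hK2]; positivity
  have hKC40 : 0 ≤ KC4 := by rw [hKC4]; positivity
  have hKC3L0 : 0 ≤ KC3L := by rw [hKC3L]; positivity
  have hK30 : 0 ≤ K3 := by rw [hK3]; positivity
  have hKΦ0 : 0 ≤ KΦ := by rw [hKΦ]; positivity
  have hLΦ0 : 0 ≤ LΦ := by rw [hLΦ]; positivity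
  refine ⟨2 * KΦ / r, 4 * KΦ / r + 2 * LΦ / (1 - r), by positivity,
    add_nonneg (by positivity) (div_nonneg (by positivity) h1r.le), ?_⟩
  intro b f hb hf i j 𝔟 𝔣 h𝔟 hL hH hM hA
  have h𝔣 : 0 ≤ 𝔣 := (norm_nonneg _).trans (hM 0)
  -- unit vectors
  set e : d → EuclideanSpace ℝ d := fun k => EuclideanSpace.single k (1 : ℝ) with he
  have hne : ∀ k, ‖e k‖ = 1 := fun k => by simp [he]
  -- the data
  set dvb : UnitAddTorus d → ℝ := fun w => ∑ k, FunctionSpaces.Torus.partialDeriv k (b k) w with hdvb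
  set h : UnitAddTorus d → F := fun w => dvb w • f w with hh_def
  have hbfs : ∀ k, FunctionSpaces.Torus.IsSmooth (fun w => b k w • f w) := fun k => (hb k).smul' hf
  have hdvbs : FunctionSpaces.Torus.IsSmooth dvb :=
    Torus.isSmooth_finset_sum Finset.univ fun k _ => (hb k).partialDeriv k
  have hhs : FunctionSpaces.Torus.IsSmooth h := hdvbs.smul' hf
  -- the Hölder bound of `h̃`
  have hdvbl : ∀ y, FunctionSpaces.Torus.lift dvb y = ∑ k, fderiv ℝ (FunctionSpaces.Torus.lift (b k)) y (e k) := by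
    intro y
    rw [FunctionSpaces.Torus.lift_apply, hdvb]
    refine Finset.sum_congr rfl fun k _ => ?_
    have := congrFun (FunctionSpaces.Torus.lift_lineDeriv ((hb k).isContDiff (by simp)) (e k)) y
    rw [FunctionSpaces.Torus.lift_apply] at this
    exact this
  have hdvbb : ∀ y, ‖FunctionSpaces.Torus.lift dvb y‖ ≤ N * 𝔟 := by
    intro y
    rw [hdvbl]
    refine (norm_sum_le _ _).trans ?_
    calc ∑ k, ‖fderiv ℝ (FunctionSpaces.Torus.lift (b k)) y (e k)‖ ≤ ∑ _k : d, 𝔟 :=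
          Finset.sum_le_sum fun k _ => (ContinuousLinearMap.le_opNorm _ _).trans
            (by rw [hne, mul_one]; exact hL k y)
      _ = N * 𝔟 := by rw [Finset.sum_const, Finset.card_univ, nsmul_eq_mul, hN]
  have hdvbH : ∀ y z, ‖FunctionSpaces.Torus.lift dvb y - FunctionSpaces.Torus.lift dvb z‖ ≤ N * 𝔟 * ‖y - z‖ ^ r := by
    intro y z
    rw [hdvbl, hdvbl, ← Finset.sum_sub_distrib]
    refine (norm_sum_le _ _).trans ?_
    calc ∑ k, ‖fderiv ℝ (FunctionSpaces.Torus.lift (b k)) y (e k) - fderiv ℝ (FunctionSpaces.Torus.lift (b k)) z (e k)‖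
        ≤ ∑ _k : d, 𝔟 * ‖y - z‖ ^ r := Finset.sum_le_sum fun k _ => by
          rw [← sub_apply]
          refine (ContinuousLinearMap.le_opNorm _ _).trans ?_
          rw [hne, mul_one]
          exact hH k y z
      _ = N * 𝔟 * ‖y - z‖ ^ r := by rw [Finset.sum_const, Finset.card_univ, nsmul_eq_mul, hN]; ring
  have hAh : ∀ y z, ‖FunctionSpaces.Torus.lift h y - FunctionSpaces.Torus.lift h z‖ ≤ (2 * N * 𝔟 * 𝔣) * ‖y - z‖ ^ r := by
    intro y z
    have hfz : ‖FunctionSpaces.Torus.lift f z‖ ≤ 𝔣 := by rw [FunctionSpaces.Torus.lift_apply]; exact hM _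
    have hsplit : FunctionSpaces.Torus.lift h y - FunctionSpaces.Torus.lift h z =
        FunctionSpaces.Torus.lift dvb y • (FunctionSpaces.Torus.lift f y - FunctionSpaces.Torus.lift f z) +
          (FunctionSpaces.Torus.lift dvb y - FunctionSpaces.Torus.lift dvb z) • FunctionSpaces.Torus.lift f z := by
      simp only [FunctionSpaces.Torus.lift_apply, hh_def, smul_sub, sub_smul]
      abel
    rw [hsplit]
    refine (norm_add_le _ _).trans ?_
    rw [norm_smul, norm_smul]
    have hρ : 0 ≤ ‖y - z‖ ^ r := Real.rpow_nonneg (norm_nonneg _) _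
    calc ‖FunctionSpaces.Torus.lift dvb y‖ * ‖FunctionSpaces.Torus.lift f y - FunctionSpaces.Torus.lift f z‖ +
          ‖FunctionSpaces.Torus.lift dvb y - FunctionSpaces.Torus.lift dvb z‖ * ‖FunctionSpaces.Torus.lift f z‖
        ≤ (N * 𝔟) * (𝔣 * ‖y - z‖ ^ r) + (N * 𝔟 * ‖y - z‖ ^ r) * 𝔣 :=
          add_le_add (mul_le_mul (hdvbb y) (hA y z) (norm_nonneg _) (by positivity))
            (mul_le_mul (hdvbH y z) hfz (norm_nonneg _) (by positivity))
      _ = (2 * N * 𝔟 * 𝔣) * ‖y - z‖ ^ r := by ring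
  have hAh0 : 0 ≤ 2 * N * 𝔟 * 𝔣 := by positivity
  -- the heat integrands
  set ΘW : d → ℝ → EuclideanSpace ℝ d → F := fun k σ x =>
    heatExtension (FunctionSpaces.Torus.lift (fun z => FunctionSpaces.Torus.lineDeriv
      (fun z' => FunctionSpaces.Torus.lineDeriv (fun z'' => FunctionSpaces.Torus.lineDeriv
        (fun w => b k w • f w) z'' (e k)) z' (e j)) z (e i))) σ x with hΘW
  set ΘU : d → ℝ → EuclideanSpace ℝ d → F := fun k σ x =>
    heatExtension (FunctionSpaces.Torus.lift (fun z => FunctionSpaces.Torus.lineDeriv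
      (fun z' => FunctionSpaces.Torus.lineDeriv (fun z'' => FunctionSpaces.Torus.lineDeriv
        f z'' (e k)) z' (e j)) z (e i))) σ x with hΘU
  set Θ0 : ℝ → EuclideanSpace ℝ d → F := fun σ x =>
    heatExtension (FunctionSpaces.Torus.lift (fun z => FunctionSpaces.Torus.lineDeriv
      (fun z' => FunctionSpaces.Torus.lineDeriv h z' (e j)) z (e i))) σ x with hΘ0
  -- the statement is about `Φ σ x = (∑ k, (ΘW k σ x - b̃ k x • ΘU k σ x)) - Θ0 σ x`
  show (∀ x, IntegrableOn (fun σ => (∑ k, (ΘW k σ x - FunctionSpaces.Torus.lift (b k) x • ΘU k σ x)) - Θ0 σ x)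
      (Ioc 0 1) ∧ ‖∫ σ in Ioc 0 1, ((∑ k, (ΘW k σ x - FunctionSpaces.Torus.lift (b k) x • ΘU k σ x)) - Θ0 σ x)‖ ≤
        2 * KΦ / r * (𝔟 * 𝔣)) ∧
    (∀ x y, ‖(∫ σ in Ioc 0 1, ((∑ k, (ΘW k σ x - FunctionSpaces.Torus.lift (b k) x • ΘU k σ x)) - Θ0 σ x)) -
        ∫ σ in Ioc 0 1, ((∑ k, (ΘW k σ y - FunctionSpaces.Torus.lift (b k) y • ΘU k σ y)) - Θ0 σ y)‖ ≤
        (4 * KΦ / r + 2 * LΦ / (1 - r)) * (𝔟 * 𝔣) * ‖x - y‖ ^ r)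
  set Φ : ℝ → EuclideanSpace ℝ d → F := fun σ x =>
    (∑ k, (ΘW k σ x - FunctionSpaces.Torus.lift (b k) x • ΘU k σ x)) - Θ0 σ x with hΦ
  -- continuity in `σ`
  have hΘWc : ∀ k x, ContinuousOn (fun σ => ΘW k σ x) (Ioi 0) := fun k x =>
    continuousOn_heatExtension_time (memLp_top_lift ((((hbfs k).lineDeriv (e k)).lineDeriv (e j)).lineDeriv (e i)).continuous) le_top x
  have hΘUc : ∀ k x, ContinuousOn (fun σ => ΘU k σ x) (Ioi 0) := fun k x =>
    continuousOn_heatExtension_time (memLp_top_lift (((hf.lineDeriv (e k)).lineDeriv (e j)).lineDeriv (e i)).continuous) le_top x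
  have hΘ0c : ∀ x, ContinuousOn (fun σ => Θ0 σ x) (Ioi 0) := fun x =>
    continuousOn_heatExtension_time (memLp_top_lift ((hhs.lineDeriv (e j)).lineDeriv (e i)).continuous) le_top x
  have hΦc : ∀ x, ContinuousOn (fun σ => Φ σ x) (Ioi 0) := fun x =>
    (continuousOn_finsetSum _ fun k _ => (hΘWc k x).sub ((hΘUc k x).const_smul _)).sub (hΘ0c x)
  -- the bounds
  have hΦb : ∀ σ ∈ Ioc (0 : ℝ) 1, ∀ x, ‖Φ σ x‖ ≤ (KΦ * (𝔟 * 𝔣)) * σ ^ (r / 2 - 1) := by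
    intro σ hσ x
    have hk : ∀ k, ‖ΘW k σ x - FunctionSpaces.Torus.lift (b k) x • ΘU k σ x‖ ≤ KC3 * (4 * 𝔟 * 𝔣) * σ ^ (r / 2 - 1) := by
      intro k
      have h3 := norm_heatComm₃_le_rpow (hb k) hf hM (hL k) h𝔟 (hH k) h𝔣 hr0.le hr1.le hA hσ.1 x (e i) (e j) (e k)
      rw [← hc, ← hcH, ← hK₁, hne, hne, hne, mul_one, mul_one, mul_one] at h3
      refine h3.trans_eq ?_
      rw [hKC3]; ring
    have h0 : ‖Θ0 σ x‖ ≤ K2 * (2 * N * 𝔟 * 𝔣) * σ ^ (r / 2 - 1) := by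
      have h2 := norm_heatExtension_lift_lineDeriv₂_le_rpow hhs hAh0 hr0.le hr1.le hAh hσ.1 x (e i) (e j)
      rw [← hc, ← hcH, hne, hne, mul_one, mul_one] at h2
      refine h2.trans_eq ?_
      rw [hK2]
    calc ‖Φ σ x‖ ≤ ‖∑ k, (ΘW k σ x - FunctionSpaces.Torus.lift (b k) x • ΘU k σ x)‖ + ‖Θ0 σ x‖ := norm_sub_le _ _
      _ ≤ (∑ _k : d, KC3 * (4 * 𝔟 * 𝔣) * σ ^ (r / 2 - 1)) + K2 * (2 * N * 𝔟 * 𝔣) * σ ^ (r / 2 - 1) :=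
          add_le_add ((norm_sum_le _ _).trans (Finset.sum_le_sum fun k _ => hk k)) h0
      _ = (KΦ * (𝔟 * 𝔣)) * σ ^ (r / 2 - 1) := by
          rw [Finset.sum_const, Finset.card_univ, nsmul_eq_mul, ← hN, hKΦ]; ring
  have hΦl : ∀ σ ∈ Ioc (0 : ℝ) 1, ∀ x y, ‖Φ σ x - Φ σ y‖ ≤ (LΦ * (𝔟 * 𝔣)) * σ ^ ((r - 3) / 2) * ‖x - y‖ := by
    intro σ hσ x y
    have hk : ∀ k, ‖(ΘW k σ x - FunctionSpaces.Torus.lift (b k) x • ΘU k σ x) -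
        (ΘW k σ y - FunctionSpaces.Torus.lift (b k) y • ΘU k σ y)‖ ≤
        (5 * KC4 + KC3L) * (𝔟 * 𝔣) * σ ^ ((r - 3) / 2) * ‖x - y‖ := by
      intro k
      have h3 := norm_heatComm₃_sub_le_rpow (hb k) hf hM (hL k) h𝔟 (hH k) h𝔣 hr0.le hr1.le hA hσ.1 (e i) (e j) (e k) x y
      rw [← hc, ← hcH, ← hK₁, hne, hne, hne, mul_one, mul_one, mul_one] at h3
      refine h3.trans_eq ?_
      rw [hKC4, hKC3L]; ring
    have h0 : ‖Θ0 σ x - Θ0 σ y‖ ≤ K3 * (2 * N * 𝔟 * 𝔣) * σ ^ ((r - 3) / 2) * ‖x - y‖ := by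
      have h2 := norm_heatExtension_lift_lineDeriv₂_sub_le_rpow hhs hAh0 hr0.le hr1.le hAh hσ.1 (e i) (e j) x y
      rw [← hc, ← hcH, hne, hne, mul_one, mul_one] at h2
      refine h2.trans_eq ?_
      rw [hK3]
    have hsplit : Φ σ x - Φ σ y = (∑ k, ((ΘW k σ x - FunctionSpaces.Torus.lift (b k) x • ΘU k σ x) -
        (ΘW k σ y - FunctionSpaces.Torus.lift (b k) y • ΘU k σ y))) - (Θ0 σ x - Θ0 σ y) := by
      rw [hΦ]; dsimp only; simp only [Finset.sum_sub_distrib]; abel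
    rw [hsplit]
    calc ‖(∑ k, ((ΘW k σ x - FunctionSpaces.Torus.lift (b k) x • ΘU k σ x) -
          (ΘW k σ y - FunctionSpaces.Torus.lift (b k) y • ΘU k σ y))) - (Θ0 σ x - Θ0 σ y)‖
        ≤ ‖∑ k, ((ΘW k σ x - FunctionSpaces.Torus.lift (b k) x • ΘU k σ x) -
          (ΘW k σ y - FunctionSpaces.Torus.lift (b k) y • ΘU k σ y))‖ + ‖Θ0 σ x - Θ0 σ y‖ := norm_sub_le _ _
      _ ≤ (∑ _k : d, (5 * KC4 + KC3L) * (𝔟 * 𝔣) * σ ^ ((r - 3) / 2) * ‖x - y‖) +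
          K3 * (2 * N * 𝔟 * 𝔣) * σ ^ ((r - 3) / 2) * ‖x - y‖ :=
          add_le_add ((norm_sum_le _ _).trans (Finset.sum_le_sum fun k _ => hk k)) h0
      _ = (LΦ * (𝔟 * 𝔣)) * σ ^ ((r - 3) / 2) * ‖x - y‖ := by
          rw [Finset.sum_const, Finset.card_univ, nsmul_eq_mul, ← hN, hLΦ]; ring
  have hKΦb : 0 ≤ KΦ * (𝔟 * 𝔣) := by positivity
  have hLΦb : 0 ≤ LΦ * (𝔟 * 𝔣) := by positivity
  have hNF : ∀ x, IntegrableOn (fun σ => Φ σ x) (Ioc 0 1) ∧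
      ‖∫ σ in Ioc 0 1, Φ σ x‖ ≤ KΦ * (𝔟 * 𝔣) / (r / 2) := fun x =>
    norm_integral_Ioc_le_of_norm_le_rpow (hΦc x) (by positivity) (fun σ hσ => hΦb σ hσ x)
  have hNH := norm_integral_Ioc_sub_le_of_bounds hr0 hr1 hKΦb hLΦb hΦc hΦb hΦl
  refine ⟨fun x => ⟨(hNF x).1, ((hNF x).2).trans_eq ?_⟩, fun x y => (hNH x y).trans_eq ?_⟩
  · field_simp
  · field_simp

/-- **The far field.** There are `F₀, F₁ ≥ 0` (depending on `d`) such that for smooth `bₖ`, `U`,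
`W₀`, `Wₖ` on `T^d` with `|bₖ| ≤ 𝔟`, `‖Db̃ₖ‖ ≤ 𝔟` (`0 ≤ 𝔟`), `‖U‖ ≤ B_U`, `‖Wₖ‖, ‖W₀‖ ≤ B_W` and
`0 < r ≤ 1`, the far field `FAR = ∑ₖ e^{Δ}(∂ₖWₖ)~ - e^{Δ}W̃₀ - ∑ₖ b̃ₖ e^{Δ}(∂ₖU)~` satisfies
`‖FAR‖ ≤ F₀ (B_W + 𝔟 B_U)` and `‖FAR(x) - FAR(y)‖ ≤ F₁ (B_W + 𝔟 B_U) ‖x - y‖^r` (smoothing bounds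
at time one and the mean value inequality). [folklore] -/
theorem exists_commutator_farField_bound (d : Type*) [Fintype d] [DecidableEq d] {r : ℝ}
    (hr0 : 0 < r) (hr1 : r ≤ 1) :
    ∃ F₀ F₁ : ℝ, 0 ≤ F₀ ∧ 0 ≤ F₁ ∧
      ∀ {b : d → UnitAddTorus d → ℝ} {U W₀ : UnitAddTorus d → F} {W : d → UnitAddTorus d → F}
        (_hb : ∀ k, FunctionSpaces.Torus.IsSmooth (b k)) (_hU : FunctionSpaces.Torus.IsSmooth U)
        (_hW₀ : FunctionSpaces.Torus.IsSmooth W₀) (_hW : ∀ k, FunctionSpaces.Torus.IsSmooth (W k))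
        {𝔟 BU BW : ℝ} (_h𝔟 : 0 ≤ 𝔟) (_hCb : ∀ k z, ‖b k z‖ ≤ 𝔟)
        (_hL : ∀ k y, ‖fderiv ℝ (FunctionSpaces.Torus.lift (b k)) y‖ ≤ 𝔟)
        (_hBU : ∀ z, ‖U z‖ ≤ BU) (_hBW : ∀ k z, ‖W k z‖ ≤ BW) (_hBW₀ : ∀ z, ‖W₀ z‖ ≤ BW),
        (∀ x, ‖(∑ k, heatExtension (FunctionSpaces.Torus.lift (FunctionSpaces.Torus.partialDeriv k (W k))) 1 x) -
            heatExtension (FunctionSpaces.Torus.lift W₀) 1 x -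
            ∑ k, FunctionSpaces.Torus.lift (b k) x •
              heatExtension (FunctionSpaces.Torus.lift (FunctionSpaces.Torus.partialDeriv k U)) 1 x‖ ≤
            F₀ * (BW + 𝔟 * BU)) ∧
        (∀ x y, ‖((∑ k, heatExtension (FunctionSpaces.Torus.lift (FunctionSpaces.Torus.partialDeriv k (W k))) 1 x) -
            heatExtension (FunctionSpaces.Torus.lift W₀) 1 x -
            ∑ k, FunctionSpaces.Torus.lift (b k) x •
              heatExtension (FunctionSpaces.Torus.lift (FunctionSpaces.Torus.partialDeriv k U)) 1 x) -
          ((∑ k, heatExtension (FunctionSpaces.Torus.lift (FunctionSpaces.Torus.partialDeriv k (W k))) 1 y) -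
            heatExtension (FunctionSpaces.Torus.lift W₀) 1 y -
            ∑ k, FunctionSpaces.Torus.lift (b k) y •
              heatExtension (FunctionSpaces.Torus.lift (FunctionSpaces.Torus.partialDeriv k U)) 1 y)‖ ≤
            F₁ * (BW + 𝔟 * BU) * ‖x - y‖ ^ r) := by
  set c : ℝ := (2 : ℝ) ^ ((Module.finrank ℝ (EuclideanSpace ℝ d) : ℝ) / 2) with hc
  set N : ℝ := (Fintype.card d : ℝ) with hN
  have hc0 : 0 < c := Real.rpow_pos_of_pos two_pos _
  have hN0 : 0 ≤ N := Nat.cast_nonneg _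
  set F0 : ℝ := N * c + 1 with hF0
  set F1 : ℝ := N * (2 * c ^ 2) + c + N * (c + 2 * c ^ 2) with hF1
  have hF00 : 0 ≤ F0 := by rw [hF0]; positivity
  have hF10 : 0 ≤ F1 := by rw [hF1]; positivity
  refine ⟨F0, F1 + 2 * F0, hF00, by positivity, ?_⟩
  intro b U W₀ W hb hU hW₀ hW 𝔟 BU BW h𝔟 hCb hL hBU hBW hBW₀
  set e : d → EuclideanSpace ℝ d := fun k => EuclideanSpace.single k (1 : ℝ) with he
  have hne : ∀ k, ‖e k‖ = 1 := fun k => by simp [he]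
  have hBU0 : 0 ≤ BU := (norm_nonneg _).trans (hBU 0)
  have hBW0 : 0 ≤ BW := (norm_nonneg _).trans (hBW₀ 0)
  set PW : d → EuclideanSpace ℝ d → F := fun k x =>
    heatExtension (FunctionSpaces.Torus.lift (FunctionSpaces.Torus.partialDeriv k (W k))) 1 x with hPW_def
  set PU : d → EuclideanSpace ℝ d → F := fun k x =>
    heatExtension (FunctionSpaces.Torus.lift (FunctionSpaces.Torus.partialDeriv k U)) 1 x with hPU_def
  set P0 : EuclideanSpace ℝ d → F := fun x => heatExtension (FunctionSpaces.Torus.lift W₀) 1 x with hP0_def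
  set B : d → EuclideanSpace ℝ d → ℝ := fun k x => FunctionSpaces.Torus.lift (b k) x with hB_def
  show (∀ x, ‖(∑ k, PW k x) - P0 x - ∑ k, B k x • PU k x‖ ≤ F0 * (BW + 𝔟 * BU)) ∧
    (∀ x y, ‖((∑ k, PW k x) - P0 x - ∑ k, B k x • PU k x) - ((∑ k, PW k y) - P0 y - ∑ k, B k y • PU k y)‖ ≤
      (F1 + 2 * F0) * (BW + 𝔟 * BU) * ‖x - y‖ ^ r)
  have hPW : ∀ k x, ‖PW k x‖ ≤ c * BW := by
    intro k x
    have h1 := norm_heatExtension_one_lift_lineDeriv_le (hW k) (hBW k) x (e k)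
    rw [← hc, hne, mul_one] at h1
    exact h1
  have hPWl : ∀ k x y, ‖PW k x - PW k y‖ ≤ 2 * c ^ 2 * BW * ‖x - y‖ := by
    intro k x y
    have h1 := norm_heatExtension_one_lift_lineDeriv_sub_le (hW k) (hBW k) (e k) x y
    rw [← hc, hne, mul_one] at h1
    exact h1
  have hPU : ∀ k x, ‖PU k x‖ ≤ c * BU := by
    intro k x
    have h1 := norm_heatExtension_one_lift_lineDeriv_le hU hBU x (e k)
    rw [← hc, hne, mul_one] at h1
    exact h1
  have hPUl : ∀ k x y, ‖PU k x - PU k y‖ ≤ 2 * c ^ 2 * BU * ‖x - y‖ := by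
    intro k x y
    have h1 := norm_heatExtension_one_lift_lineDeriv_sub_le hU hBU (e k) x y
    rw [← hc, hne, mul_one] at h1
    exact h1
  have hP0 : ∀ x, ‖P0 x‖ ≤ BW := fun x => norm_heatExtension_lift_le hBW₀ one_pos x
  have hP0l : ∀ x y, ‖P0 x - P0 y‖ ≤ c * BW * ‖x - y‖ := by
    intro x y
    have h1 := norm_heatExtension_one_lift_sub_le hW₀ hBW₀ x y
    rw [← hc] at h1
    exact h1
  have hbl : ∀ k x, ‖B k x‖ ≤ 𝔟 := fun k x => by
    rw [hB_def]; dsimp only; rw [FunctionSpaces.Torus.lift_apply]; exact hCb k _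
  have hbll : ∀ k x y, ‖B k x - B k y‖ ≤ 𝔟 * ‖x - y‖ :=
    fun k x y => norm_lift_sub_lift_le_of_fderiv_le (hb k) (hL k) x y
  -- sup bound
  have hF0b : ∀ x, ‖(∑ k, PW k x) - P0 x - ∑ k, B k x • PU k x‖ ≤ F0 * (BW + 𝔟 * BU) := by
    intro x
    have hk : ∀ k, ‖B k x • PU k x‖ ≤ 𝔟 * (c * BU) := fun k => by
      rw [norm_smul]; exact mul_le_mul (hbl k x) (hPU k x) (norm_nonneg _) h𝔟
    have hmono : (N * c) * (𝔟 * BU) ≤ (N * c + 1) * (𝔟 * BU) :=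
      mul_le_mul_of_nonneg_right (by linarith) (mul_nonneg h𝔟 hBU0)
    calc ‖(∑ k, PW k x) - P0 x - ∑ k, B k x • PU k x‖
        ≤ ‖(∑ k, PW k x) - P0 x‖ + ‖∑ k, B k x • PU k x‖ := norm_sub_le _ _
      _ ≤ (‖∑ k, PW k x‖ + ‖P0 x‖) + ‖∑ k, B k x • PU k x‖ := add_le_add (norm_sub_le _ _) le_rfl
      _ ≤ ((∑ _k : d, c * BW) + BW) + ∑ _k : d, 𝔟 * (c * BU) :=
          add_le_add (add_le_add ((norm_sum_le _ _).trans (Finset.sum_le_sum fun k _ => hPW k x)) (hP0 x))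
            ((norm_sum_le _ _).trans (Finset.sum_le_sum fun k _ => hk k))
      _ = (N * c + 1) * BW + (N * c) * (𝔟 * BU) := by
          rw [Finset.sum_const, Finset.sum_const, Finset.card_univ, nsmul_eq_mul, nsmul_eq_mul, ← hN]; ring
      _ ≤ (N * c + 1) * BW + (N * c + 1) * (𝔟 * BU) := add_le_add le_rfl hmono
      _ = F0 * (BW + 𝔟 * BU) := by rw [hF0]; ring
  -- Lipschitz bound
  have hF1b : ∀ x y, ‖((∑ k, PW k x) - P0 x - ∑ k, B k x • PU k x) - ((∑ k, PW k y) - P0 y - ∑ k, B k y • PU k y)‖ ≤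
      F1 * (BW + 𝔟 * BU) * ‖x - y‖ := by
    intro x y
    have hsplit : ((∑ k, PW k x) - P0 x - ∑ k, B k x • PU k x) - ((∑ k, PW k y) - P0 y - ∑ k, B k y • PU k y) =
        (∑ k, (PW k x - PW k y)) - (P0 x - P0 y) -
          ∑ k, ((B k x - B k y) • PU k x + B k y • (PU k x - PU k y)) := by
      simp only [sub_smul, smul_sub, Finset.sum_sub_distrib, Finset.sum_add_distrib]
      abel
    rw [hsplit]
    have hk : ∀ k, ‖(B k x - B k y) • PU k x + B k y • (PU k x - PU k y)‖ ≤
        (𝔟 * ‖x - y‖) * (c * BU) + 𝔟 * (2 * c ^ 2 * BU * ‖x - y‖) := by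
      intro k
      refine (norm_add_le _ _).trans (add_le_add ?_ ?_)
      · rw [norm_smul]; exact mul_le_mul (hbll k x y) (hPU k x) (norm_nonneg _) (by positivity)
      · rw [norm_smul]; exact mul_le_mul (hbl k y) (hPUl k x y) (norm_nonneg _) h𝔟
    have hρ : 0 ≤ ‖x - y‖ := norm_nonneg _
    have hmono : (N * (c + 2 * c ^ 2)) * (𝔟 * BU) * ‖x - y‖ ≤ F1 * (𝔟 * BU) * ‖x - y‖ := by
      refine mul_le_mul_of_nonneg_right (mul_le_mul_of_nonneg_right ?_ (mul_nonneg h𝔟 hBU0)) hρ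
      rw [hF1]; nlinarith [hc0.le, hN0]
    have hmono' : (N * (2 * c ^ 2) + c) * BW * ‖x - y‖ ≤ F1 * BW * ‖x - y‖ := by
      refine mul_le_mul_of_nonneg_right (mul_le_mul_of_nonneg_right ?_ hBW0) hρ
      rw [hF1]; nlinarith [hc0.le, hN0]
    calc ‖(∑ k, (PW k x - PW k y)) - (P0 x - P0 y) - ∑ k, ((B k x - B k y) • PU k x + B k y • (PU k x - PU k y))‖
        ≤ ‖(∑ k, (PW k x - PW k y)) - (P0 x - P0 y)‖ +
            ‖∑ k, ((B k x - B k y) • PU k x + B k y • (PU k x - PU k y))‖ := norm_sub_le _ _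
      _ ≤ (‖∑ k, (PW k x - PW k y)‖ + ‖P0 x - P0 y‖) +
            ‖∑ k, ((B k x - B k y) • PU k x + B k y • (PU k x - PU k y))‖ := add_le_add (norm_sub_le _ _) le_rfl
      _ ≤ ((∑ _k : d, 2 * c ^ 2 * BW * ‖x - y‖) + c * BW * ‖x - y‖) +
            ∑ _k : d, ((𝔟 * ‖x - y‖) * (c * BU) + 𝔟 * (2 * c ^ 2 * BU * ‖x - y‖)) :=
          add_le_add (add_le_add ((norm_sum_le _ _).trans (Finset.sum_le_sum fun k _ => hPWl k x y)) (hP0l x y))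
            ((norm_sum_le _ _).trans (Finset.sum_le_sum fun k _ => hk k))
      _ = (N * (2 * c ^ 2) + c) * BW * ‖x - y‖ + (N * (c + 2 * c ^ 2)) * (𝔟 * BU) * ‖x - y‖ := by
          rw [Finset.sum_const, Finset.sum_const, Finset.card_univ, nsmul_eq_mul, nsmul_eq_mul, ← hN]; ring
      _ ≤ F1 * BW * ‖x - y‖ + F1 * (𝔟 * BU) * ‖x - y‖ := add_le_add hmono' hmono
      _ = F1 * (BW + 𝔟 * BU) * ‖x - y‖ := by ring
  refine ⟨hF0b, fun x y => ?_⟩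
  -- Hölder from Lipschitz and sup
  set ρ : ℝ := ‖x - y‖ with hρ
  have hρ0 : 0 ≤ ρ := norm_nonneg _
  have hQ : 0 ≤ BW + 𝔟 * BU := by positivity
  rcases le_or_gt ρ 1 with hle | hgt
  · have hρr : ρ ≤ ρ ^ r := by
      rcases hρ0.eq_or_lt with h0 | hpos
      · rw [← h0, Real.zero_rpow hr0.ne']
      · exact Real.self_le_rpow_of_le_one hρ0 hle hr1
    calc ‖((∑ k, PW k x) - P0 x - ∑ k, B k x • PU k x) - ((∑ k, PW k y) - P0 y - ∑ k, B k y • PU k y)‖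
        ≤ F1 * (BW + 𝔟 * BU) * ρ := hF1b x y
      _ ≤ F1 * (BW + 𝔟 * BU) * ρ ^ r := mul_le_mul_of_nonneg_left hρr (by positivity)
      _ ≤ (F1 + 2 * F0) * (BW + 𝔟 * BU) * ρ ^ r := by
          have : F1 ≤ F1 + 2 * F0 := by linarith
          have hρr0 : 0 ≤ ρ ^ r := Real.rpow_nonneg hρ0 r
          gcongr
  · have h1 : 1 ≤ ρ ^ r := Real.one_le_rpow hgt.le hr0.le
    calc ‖((∑ k, PW k x) - P0 x - ∑ k, B k x • PU k x) - ((∑ k, PW k y) - P0 y - ∑ k, B k y • PU k y)‖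
        ≤ ‖(∑ k, PW k x) - P0 x - ∑ k, B k x • PU k x‖ + ‖(∑ k, PW k y) - P0 y - ∑ k, B k y • PU k y‖ :=
          norm_sub_le _ _
      _ ≤ F0 * (BW + 𝔟 * BU) + F0 * (BW + 𝔟 * BU) := add_le_add (hF0b x) (hF0b y)
      _ = (2 * F0) * (BW + 𝔟 * BU) * 1 := by ring
      _ ≤ (F1 + 2 * F0) * (BW + 𝔟 * BU) * ρ ^ r := by
          have : 2 * F0 ≤ F1 + 2 * F0 := by linarith
          gcongr

/-- **The representation `([T,b·∇]f)~ = FAR - ∫₀¹ Φ_σ dσ`.** For smooth `bₖ, f, U, W₀, Wₖ` with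
`Δ(∂ₖU) = ∂ᵢ∂ⱼ∂ₖf`, `Δ(∂ₖWₖ) = ∂ᵢ∂ⱼ∂ₖ(bₖf)`, `ΔW₀ = ∂ᵢ∂ⱼ((∑ₖ∂ₖbₖ)f)`, the lift of
`g = ∑ₖ ∂ₖWₖ - W₀ - ∑ₖ bₖ ∂ₖU` is the far field minus the time integral of the near field
(`lift_eq_heatExtension_one_sub_integral` for each of `∂ₖWₖ`, `W₀`, `∂ₖU`; every heat integrand is
integrable on `(0,1]` by smoothness). [folklore] -/
theorem lift_commutator_eq_far_sub_integral {d : Type*} [Fintype d] [DecidableEq d]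
    {b : d → UnitAddTorus d → ℝ} {f U W₀ : UnitAddTorus d → F} {W : d → UnitAddTorus d → F}
    (hb : ∀ k, FunctionSpaces.Torus.IsSmooth (b k)) (hf : FunctionSpaces.Torus.IsSmooth f)
    (hU : FunctionSpaces.Torus.IsSmooth U) (hW₀ : FunctionSpaces.Torus.IsSmooth W₀)
    (hW : ∀ k, FunctionSpaces.Torus.IsSmooth (W k)) (i j : d)
    (hΔU : ∀ k z, FunctionSpaces.Torus.laplacian (FunctionSpaces.Torus.partialDeriv k U) z =
      FunctionSpaces.Torus.partialDeriv i (FunctionSpaces.Torus.partialDeriv j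
        (FunctionSpaces.Torus.partialDeriv k f)) z)
    (hΔW : ∀ k z, FunctionSpaces.Torus.laplacian (FunctionSpaces.Torus.partialDeriv k (W k)) z =
      FunctionSpaces.Torus.partialDeriv i (FunctionSpaces.Torus.partialDeriv j
        (FunctionSpaces.Torus.partialDeriv k (fun w => b k w • f w))) z)
    (hΔW₀ : ∀ z, FunctionSpaces.Torus.laplacian W₀ z =
      FunctionSpaces.Torus.partialDeriv i (FunctionSpaces.Torus.partialDeriv j
        (fun w => (∑ k, FunctionSpaces.Torus.partialDeriv k (b k) w) • f w)) z)
    (x : EuclideanSpace ℝ d) :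
    FunctionSpaces.Torus.lift (fun z => (∑ k, FunctionSpaces.Torus.partialDeriv k (W k) z) - W₀ z -
        ∑ k, b k z • FunctionSpaces.Torus.partialDeriv k U z) x =
      ((∑ k, heatExtension (FunctionSpaces.Torus.lift (FunctionSpaces.Torus.partialDeriv k (W k))) 1 x) -
          heatExtension (FunctionSpaces.Torus.lift W₀) 1 x -
          ∑ k, FunctionSpaces.Torus.lift (b k) x •
            heatExtension (FunctionSpaces.Torus.lift (FunctionSpaces.Torus.partialDeriv k U)) 1 x) -
        ∫ σ in Ioc 0 1, ((∑ k, (heatExtension (FunctionSpaces.Torus.lift (fun z =>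
            FunctionSpaces.Torus.lineDeriv (fun z' => FunctionSpaces.Torus.lineDeriv (fun z'' =>
              FunctionSpaces.Torus.lineDeriv (fun w => b k w • f w) z'' (EuclideanSpace.single k (1 : ℝ)))
              z' (EuclideanSpace.single j (1 : ℝ))) z (EuclideanSpace.single i (1 : ℝ)))) σ x -
          FunctionSpaces.Torus.lift (b k) x • heatExtension (FunctionSpaces.Torus.lift (fun z =>
            FunctionSpaces.Torus.lineDeriv (fun z' => FunctionSpaces.Torus.lineDeriv (fun z'' =>
              FunctionSpaces.Torus.lineDeriv f z'' (EuclideanSpace.single k (1 : ℝ)))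
              z' (EuclideanSpace.single j (1 : ℝ))) z (EuclideanSpace.single i (1 : ℝ)))) σ x)) -
          heatExtension (FunctionSpaces.Torus.lift (fun z => FunctionSpaces.Torus.lineDeriv (fun z' =>
            FunctionSpaces.Torus.lineDeriv (fun w => (∑ k, FunctionSpaces.Torus.partialDeriv k (b k) w) • f w)
              z' (EuclideanSpace.single j (1 : ℝ))) z (EuclideanSpace.single i (1 : ℝ)))) σ x) := by
  set e : d → EuclideanSpace ℝ d := fun k => EuclideanSpace.single k (1 : ℝ) with he
  have hbfs : ∀ k, FunctionSpaces.Torus.IsSmooth (fun w => b k w • f w) := fun k => (hb k).smul' hf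
  have hdvbs : FunctionSpaces.Torus.IsSmooth (fun w => ∑ k, FunctionSpaces.Torus.partialDeriv k (b k) w) :=
    Torus.isSmooth_finset_sum Finset.univ fun k _ => (hb k).partialDeriv k
  have hhs : FunctionSpaces.Torus.IsSmooth (fun w => (∑ k, FunctionSpaces.Torus.partialDeriv k (b k) w) • f w) :=
    hdvbs.smul' hf
  set ΘW : d → ℝ → EuclideanSpace ℝ d → F := fun k σ x =>
    heatExtension (FunctionSpaces.Torus.lift (fun z => FunctionSpaces.Torus.lineDeriv
      (fun z' => FunctionSpaces.Torus.lineDeriv (fun z'' => FunctionSpaces.Torus.lineDeriv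
        (fun w => b k w • f w) z'' (e k)) z' (e j)) z (e i))) σ x with hΘW
  set ΘU : d → ℝ → EuclideanSpace ℝ d → F := fun k σ x =>
    heatExtension (FunctionSpaces.Torus.lift (fun z => FunctionSpaces.Torus.lineDeriv
      (fun z' => FunctionSpaces.Torus.lineDeriv (fun z'' => FunctionSpaces.Torus.lineDeriv
        f z'' (e k)) z' (e j)) z (e i))) σ x with hΘU
  set Θ0 : ℝ → EuclideanSpace ℝ d → F := fun σ x =>
    heatExtension (FunctionSpaces.Torus.lift (fun z => FunctionSpaces.Torus.lineDeriv
      (fun z' => FunctionSpaces.Torus.lineDeriv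
        (fun w => (∑ k, FunctionSpaces.Torus.partialDeriv k (b k) w) • f w) z' (e j)) z (e i))) σ x with hΘ0
  show _ = _ - ∫ σ in Ioc 0 1, ((∑ k, (ΘW k σ x - FunctionSpaces.Torus.lift (b k) x • ΘU k σ x)) - Θ0 σ x)
  -- integrability of the pieces on `(0, 1]`
  have hIW : ∀ k, IntegrableOn (fun σ => ΘW k σ x) (Ioc 0 1) := fun k =>
    integrableOn_heatExtension_lift_lineDeriv₂ ((hbfs k).lineDeriv (e k)) (e i) (e j) x
  have hIU : ∀ k, IntegrableOn (fun σ => ΘU k σ x) (Ioc 0 1) := fun k =>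
    integrableOn_heatExtension_lift_lineDeriv₂ (hf.lineDeriv (e k)) (e i) (e j) x
  have hI0 : IntegrableOn (fun σ => Θ0 σ x) (Ioc 0 1) :=
    integrableOn_heatExtension_lift_lineDeriv₂ hhs (e i) (e j) x
  have hIU' : ∀ k, IntegrableOn (fun σ => FunctionSpaces.Torus.lift (b k) x • ΘU k σ x) (Ioc 0 1) :=
    fun k => (hIU k).smul _
  have hIk : ∀ k, IntegrableOn (fun σ => ΘW k σ x - FunctionSpaces.Torus.lift (b k) x • ΘU k σ x) (Ioc 0 1) :=
    fun k => (hIW k).sub (hIU' k)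
  have hIs : IntegrableOn (fun σ => ∑ k, (ΘW k σ x - FunctionSpaces.Torus.lift (b k) x • ΘU k σ x)) (Ioc 0 1) :=
    integrable_finsetSum _ fun k _ => hIk k
  -- the representations
  have hrepW : ∀ k, FunctionSpaces.Torus.lift (FunctionSpaces.Torus.partialDeriv k (W k)) x =
      heatExtension (FunctionSpaces.Torus.lift (FunctionSpaces.Torus.partialDeriv k (W k))) 1 x -
        ∫ σ in Ioc 0 1, ΘW k σ x := fun k =>
    lift_eq_heatExtension_one_sub_integral ((hW k).partialDeriv k) (fun z => hΔW k z) x (hIW k)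
  have hrepU : ∀ k, FunctionSpaces.Torus.lift (FunctionSpaces.Torus.partialDeriv k U) x =
      heatExtension (FunctionSpaces.Torus.lift (FunctionSpaces.Torus.partialDeriv k U)) 1 x -
        ∫ σ in Ioc 0 1, ΘU k σ x := fun k =>
    lift_eq_heatExtension_one_sub_integral (hU.partialDeriv k) (fun z => hΔU k z) x (hIU k)
  have hrep0 : FunctionSpaces.Torus.lift W₀ x =
      heatExtension (FunctionSpaces.Torus.lift W₀) 1 x - ∫ σ in Ioc 0 1, Θ0 σ x :=
    lift_eq_heatExtension_one_sub_integral hW₀ (fun z => hΔW₀ z) x hI0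
  -- the integral of `Φ`
  have hintΦ : ∫ σ in Ioc 0 1, ((∑ k, (ΘW k σ x - FunctionSpaces.Torus.lift (b k) x • ΘU k σ x)) - Θ0 σ x) =
      (∑ k, ((∫ σ in Ioc 0 1, ΘW k σ x) - FunctionSpaces.Torus.lift (b k) x • ∫ σ in Ioc 0 1, ΘU k σ x)) -
        ∫ σ in Ioc 0 1, Θ0 σ x := by
    rw [integral_sub hIs hI0, integral_finsetSum _ fun k _ => hIk k]
    congr 1
    refine Finset.sum_congr rfl fun k _ => ?_
    rw [integral_sub (hIW k) (hIU' k), integral_smul]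
  have hl : FunctionSpaces.Torus.lift (fun z => (∑ k, FunctionSpaces.Torus.partialDeriv k (W k) z) - W₀ z -
      ∑ k, b k z • FunctionSpaces.Torus.partialDeriv k U z) x =
      (∑ k, FunctionSpaces.Torus.lift (FunctionSpaces.Torus.partialDeriv k (W k)) x) -
        FunctionSpaces.Torus.lift W₀ x -
        ∑ k, FunctionSpaces.Torus.lift (b k) x • FunctionSpaces.Torus.lift (FunctionSpaces.Torus.partialDeriv k U) x := rfl
  rw [hl, hintΦ, hrep0]
  simp only [hrepW, hrepU, smul_sub, Finset.sum_sub_distrib]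
  abel

/-- **The `C^α` commutator estimate through the heat semigroup (abstract real form).** Fix
`0 < r < 1`. There is `K = K(d, r) ≥ 0` such that: for smooth `bₖ` (`k : d`), `f`, `U`, `W₀`, `Wₖ`
on `T^d` and coordinates `i, j` with `Δ(∂ₖU) = ∂ᵢ∂ⱼ∂ₖf`, `Δ(∂ₖWₖ) = ∂ᵢ∂ⱼ∂ₖ(bₖf)`,
`ΔW₀ = ∂ᵢ∂ⱼ((∑ₖ∂ₖbₖ)f)` (for `∂ᵢ∂ⱼΔ⁻¹` on `T³`: `U = Tf`, `Wₖ = T(bₖf)`, `W₀ = T((div b)f)`), and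
real bounds `|bₖ|, ‖Db̃ₖ‖, [Db̃ₖ]_r ≤ 𝔟`, `‖f‖, [f̃]_r ≤ 𝔣`, `‖U‖ ≤ B_U`, `‖Wₖ‖, ‖W₀‖ ≤ B_W`, the
function `g = ∑ₖ ∂ₖWₖ - W₀ - ∑ₖ bₖ ∂ₖU` (`= [T, b·∇]f`) satisfies
`‖g̃‖ ≤ K (𝔟𝔣 + B_W + 𝔟 B_U)` and `‖g̃(x) - g̃(y)‖ ≤ K (𝔟𝔣 + B_W + 𝔟 B_U) ‖x - y‖^r`
(`lift_commutator_eq_far_sub_integral`, `exists_commutator_nearField_bound`,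
`exists_commutator_farField_bound`). [cite: BuckmasterEtAl2018, App. D Prop. D.1] -/
theorem exists_commutator_holder_bound (d : Type*) [Fintype d] [DecidableEq d] {r : ℝ}
    (hr0 : 0 < r) (hr1 : r < 1) :
    ∃ K : ℝ, 0 ≤ K ∧
      ∀ {b : d → UnitAddTorus d → ℝ} {f U W₀ : UnitAddTorus d → F} {W : d → UnitAddTorus d → F}
        (_hb : ∀ k, FunctionSpaces.Torus.IsSmooth (b k)) (_hf : FunctionSpaces.Torus.IsSmooth f)
        (_hU : FunctionSpaces.Torus.IsSmooth U) (_hW₀ : FunctionSpaces.Torus.IsSmooth W₀)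
        (_hW : ∀ k, FunctionSpaces.Torus.IsSmooth (W k)) (i j : d)
        (_hΔU : ∀ k z, FunctionSpaces.Torus.laplacian (FunctionSpaces.Torus.partialDeriv k U) z =
          FunctionSpaces.Torus.partialDeriv i (FunctionSpaces.Torus.partialDeriv j
            (FunctionSpaces.Torus.partialDeriv k f)) z)
        (_hΔW : ∀ k z, FunctionSpaces.Torus.laplacian (FunctionSpaces.Torus.partialDeriv k (W k)) z =
          FunctionSpaces.Torus.partialDeriv i (FunctionSpaces.Torus.partialDeriv j
            (FunctionSpaces.Torus.partialDeriv k (fun w => b k w • f w))) z)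
        (_hΔW₀ : ∀ z, FunctionSpaces.Torus.laplacian W₀ z =
          FunctionSpaces.Torus.partialDeriv i (FunctionSpaces.Torus.partialDeriv j
            (fun w => (∑ k, FunctionSpaces.Torus.partialDeriv k (b k) w) • f w)) z)
        {𝔟 𝔣 BU BW : ℝ}
        (_hCb : ∀ k z, ‖b k z‖ ≤ 𝔟) (_hL : ∀ k y, ‖fderiv ℝ (FunctionSpaces.Torus.lift (b k)) y‖ ≤ 𝔟)
        (_hH : ∀ k a a', ‖fderiv ℝ (FunctionSpaces.Torus.lift (b k)) a -
          fderiv ℝ (FunctionSpaces.Torus.lift (b k)) a'‖ ≤ 𝔟 * ‖a - a'‖ ^ r)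
        (_hM : ∀ z, ‖f z‖ ≤ 𝔣)
        (_hA : ∀ y z, ‖FunctionSpaces.Torus.lift f y - FunctionSpaces.Torus.lift f z‖ ≤ 𝔣 * ‖y - z‖ ^ r)
        (_hBU : ∀ z, ‖U z‖ ≤ BU) (_hBW : ∀ k z, ‖W k z‖ ≤ BW) (_hBW₀ : ∀ z, ‖W₀ z‖ ≤ BW),
        (∀ x, ‖FunctionSpaces.Torus.lift (fun z => (∑ k, FunctionSpaces.Torus.partialDeriv k (W k) z) - W₀ z -
            ∑ k, b k z • FunctionSpaces.Torus.partialDeriv k U z) x‖ ≤ K * (𝔟 * 𝔣 + BW + 𝔟 * BU)) ∧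
        (∀ x y, ‖FunctionSpaces.Torus.lift (fun z => (∑ k, FunctionSpaces.Torus.partialDeriv k (W k) z) - W₀ z -
            ∑ k, b k z • FunctionSpaces.Torus.partialDeriv k U z) x -
          FunctionSpaces.Torus.lift (fun z => (∑ k, FunctionSpaces.Torus.partialDeriv k (W k) z) - W₀ z -
            ∑ k, b k z • FunctionSpaces.Torus.partialDeriv k U z) y‖ ≤
            K * (𝔟 * 𝔣 + BW + 𝔟 * BU) * ‖x - y‖ ^ r) := by
  obtain ⟨K₀, L₀, hK₀, hL₀, hnear⟩ := exists_commutator_nearField_bound (F := F) d hr0 hr1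
  obtain ⟨F₀, F₁, hF₀, hF₁, hfar⟩ := exists_commutator_farField_bound (F := F) d hr0 hr1.le
  refine ⟨F₀ + F₁ + K₀ + L₀, by positivity, ?_⟩
  intro b f U W₀ W hb hf hU hW₀ hW i j hΔU hΔW hΔW₀ 𝔟 𝔣 BU BW hCb hL hH hM hA hBU hBW hBW₀
  have h𝔟 : 0 ≤ 𝔟 := (norm_nonneg _).trans (hCb i 0)
  have h𝔣 : 0 ≤ 𝔣 := (norm_nonneg _).trans (hM 0)
  have hBU0 : 0 ≤ BU := (norm_nonneg _).trans (hBU 0)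
  have hBW0 : 0 ≤ BW := (norm_nonneg _).trans (hBW₀ 0)
  obtain ⟨hN1, hN2⟩ := hnear hb hf i j h𝔟 hL hH hM hA
  obtain ⟨hFa, hFb⟩ := hfar hb hU hW₀ hW h𝔟 hCb hL hBU hBW hBW₀
  have hrep := lift_commutator_eq_far_sub_integral hb hf hU hW₀ hW i j hΔU hΔW hΔW₀
  have hQ : 0 ≤ 𝔟 * 𝔣 + BW + 𝔟 * BU := by positivity
  have hc1 : F₀ ≤ F₀ + F₁ + K₀ + L₀ := by linarith
  have hc2 : K₀ ≤ F₀ + F₁ + K₀ + L₀ := by linarith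
  have hc3 : F₁ ≤ F₀ + F₁ + K₀ + L₀ := by linarith
  have hc4 : L₀ ≤ F₀ + F₁ + K₀ + L₀ := by linarith
  refine ⟨fun x => ?_, fun x y => ?_⟩
  · rw [hrep x]
    refine (norm_sub_le _ _).trans ?_
    calc _ ≤ F₀ * (BW + 𝔟 * BU) + K₀ * (𝔟 * 𝔣) := add_le_add (hFa x) (hN1 x).2
      _ ≤ (F₀ + F₁ + K₀ + L₀) * (BW + 𝔟 * BU) + (F₀ + F₁ + K₀ + L₀) * (𝔟 * 𝔣) := by gcongr
      _ = (F₀ + F₁ + K₀ + L₀) * (𝔟 * 𝔣 + BW + 𝔟 * BU) := by ring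
  · rw [hrep x, hrep y]
    have hρ : 0 ≤ ‖x - y‖ ^ r := Real.rpow_nonneg (norm_nonneg _) _
    rw [sub_sub_sub_comm]
    refine (norm_sub_le _ _).trans ?_
    calc _ ≤ F₁ * (BW + 𝔟 * BU) * ‖x - y‖ ^ r + L₀ * (𝔟 * 𝔣) * ‖x - y‖ ^ r := add_le_add (hFb x y) (hN2 x y)
      _ ≤ (F₀ + F₁ + K₀ + L₀) * (BW + 𝔟 * BU) * ‖x - y‖ ^ r +
          (F₀ + F₁ + K₀ + L₀) * (𝔟 * 𝔣) * ‖x - y‖ ^ r := by gcongr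
      _ = (F₀ + F₁ + K₀ + L₀) * (𝔟 * 𝔣 + BW + 𝔟 * BU) * ‖x - y‖ ^ r := by ring

end Commutator

/-! ## Real bounds from extended norms -/

section RealBounds

variable {X Y : Type*} [NormedAddCommGroup Y]

/-- A pointwise real bound from `eSupNorm g ≤ ofReal M`. [folklore] -/
theorem norm_le_of_eSupNorm_le {g : X → Y} {M : ℝ} (hM : 0 ≤ M)
    (h : FunctionSpaces.eSupNorm g ≤ ENNReal.ofReal M) (x : X) : ‖g x‖ ≤ M := by
  have h1 := (FunctionSpaces.enorm_le_eSupNorm g x).trans h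
  rwa [← ofReal_norm, ENNReal.ofReal_le_ofReal_iff hM] at h1

/-- A real Hölder bound from `eHolderNorm r g ≤ ofReal M` (real normed source). [folklore] -/
theorem norm_sub_le_of_eHolderNorm_le [NormedAddCommGroup X] {g : X → Y} {r : ℝ≥0} {M : ℝ}
    (hM : 0 ≤ M) (h : eHolderNorm r g ≤ ENNReal.ofReal M) (x y : X) :
    ‖g x - g y‖ ≤ M * ‖x - y‖ ^ (r : ℝ) := by
  have hne : eHolderNorm r g ≠ ⊤ := ne_top_of_le_ne_top ENNReal.ofReal_ne_top h
  refine (FunctionSpaces.norm_sub_le_toReal_eHolderNorm hne x y).trans ?_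
  exact mul_le_mul_of_nonneg_right (ENNReal.toReal_le_of_le_ofReal hM h) (Real.rpow_nonneg (norm_nonneg _) _)

end RealBounds

end TorusHeat

namespace BDSV

open FunctionSpaces FunctionSpaces.Torus

variable {F : Type*} [NormedAddCommGroup F] [NormedSpace ℝ F]

/-- `∂ᵢ∂ⱼΔ⁻¹` of a finite sum of smooth functions. [folklore] -/
theorem rieszHessian_finset_sum {ι : Type*} (s : Finset ι) {g : ι → UnitAddTorus (Fin 3) → F}
    (hg : ∀ l ∈ s, IsSmooth (g l)) (i j : Fin 3) :
    rieszHessian i j (fun y => ∑ l ∈ s, g l y) = fun y => ∑ l ∈ s, rieszHessian i j (g l) y := by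
  classical
  induction s using Finset.induction_on with
  | empty =>
    simp only [Finset.sum_empty]
    exact rieszHessian_zero i j
  | insert a s ha ih =>
    have hs : ∀ l ∈ s, IsSmooth (g l) := fun l hl => hg l (Finset.mem_insert_of_mem hl)
    have hsum : IsSmooth (fun y => ∑ l ∈ s, g l y) := Torus.isSmooth_finset_sum s hs
    simp only [Finset.sum_insert ha]
    have h1 : (fun y => g a y + ∑ l ∈ s, g l y) = g a + fun y => ∑ l ∈ s, g l y := rfl
    rw [h1, rieszHessian_add (hg a (Finset.mem_insert_self a s)) hsum, ih hs]
    rfl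

/-- **The rearrangement of the commutator.** For smooth `b : T³ → ℝ³`, `f : T³ → ℝ` and
`T = ∂ᵢ∂ⱼΔ⁻¹`: `T(b·∇f) - b·∇(Tf) = ∑ₖ ∂ₖT(bₖf) - T((∑ₖ∂ₖbₖ) f) - ∑ₖ bₖ ∂ₖ(Tf)`
(`b·∇f = ∑ₖ (∂ₖ(bₖf) - (∂ₖbₖ)f)`, linearity of `T` and `∂ₖT = T∂ₖ`). [folklore] -/
theorem rieszHessian_convect_sub_convect_rieszHessian_eq
    {b : UnitAddTorus (Fin 3) → EuclideanSpace ℝ (Fin 3)} {f : UnitAddTorus (Fin 3) → ℝ}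
    (hb : IsSmooth b) (hf : IsSmooth f) (i j : Fin 3) :
    (fun x => rieszHessian i j (Torus.convect b f) x - Torus.convect b (rieszHessian i j f) x) =
      fun z => (∑ k, Torus.partialDeriv k (rieszHessian i j (fun w => b w k • f w)) z) -
        rieszHessian i j (fun w => (∑ k, Torus.partialDeriv k (fun y => b y k) w) • f w) z -
        ∑ k, b z k • Torus.partialDeriv k (rieszHessian i j f) z := by
  have hbk : ∀ k, IsSmooth (fun y => b y k) := fun k => hb.apply k
  have hbf : ∀ k, IsSmooth (fun w => b w k • f w) := fun k => (hbk k).smul' hf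
  have hdv : IsSmooth (fun w => ∑ k, Torus.partialDeriv k (fun y => b y k) w) :=
    Torus.isSmooth_finset_sum _ fun k _ => (hbk k).partialDeriv k
  have hh : IsSmooth (fun w => (∑ k, Torus.partialDeriv k (fun y => b y k) w) • f w) := hdv.smul' hf
  have hS : IsSmooth (fun w => ∑ k, Torus.partialDeriv k (fun w => b w k • f w) w) :=
    Torus.isSmooth_finset_sum _ fun k _ => (hbf k).partialDeriv k
  have hf1 : IsContDiff 1 f := hf.isContDiff (by simp)
  -- `b·∇f = ∑ₖ ∂ₖ(bₖ f) - (div b) f`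
  have hconv : Torus.convect b f = (fun w => ∑ k, Torus.partialDeriv k (fun w => b w k • f w) w) -
      (fun w => (∑ k, Torus.partialDeriv k (fun y => b y k) w) • f w) := by
    funext w
    rw [Torus.convect, fderiv_apply_eq_sum_partialDeriv hf1 w (b w), Pi.sub_apply, Finset.sum_smul,
      ← Finset.sum_sub_distrib]
    refine Finset.sum_congr rfl fun k _ => ?_
    rw [partialDeriv_smul ((hbk k).isContDiff (by simp)) hf1 k w]
    simp only [smul_eq_mul]
    ring
  funext x
  rw [hconv, rieszHessian_sub hS hh, Pi.sub_apply, rieszHessian_finset_sum _ (fun k _ => (hbf k).partialDeriv k),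
    Torus.convect, fderiv_apply_eq_sum_partialDeriv ((isSmooth_rieszHessian hf i j).isContDiff (by simp)) x (b x)]
  congr 2
  refine Finset.sum_congr rfl fun k _ => ?_
  rw [partialDeriv_rieszHessian (hbf k)]

/-- **BDSV App. D, Prop. D.1, case `N = 0`, for `∂ᵢ∂ⱼΔ⁻¹`.** For `0 < α < 1` there is
`C = C(α)` such that for all `i, j`, all smooth vector fields `b : T³ → ℝ³` and smooth real `f`,
`‖∂ᵢ∂ⱼΔ⁻¹((b·∇)f) - (b·∇)∂ᵢ∂ⱼΔ⁻¹f‖_{C^{0,α}} ≤ C ‖b‖_{C^{1,α}} ‖f‖_{C^{0,α}}` (norms of the periodic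
lifts, `Torus.eContDiffHolderNorm`). Printed: "`‖[T_K, b·∇]f‖_{α} ≲ ‖b‖_{1+α}‖f‖_{α}` … The case
`N = 0` is precisely Lemma 1 in [Co2015]" (BDSV 2019, App. D, Prop. D.1 and its proof). Proof here:
`TorusHeat.exists_commutator_holder_bound` (heat semigroup) with `U = Tf`, `Wₖ = T(bₖf)`,
`W₀ = T((div b)f)`, whose sup bounds come from `BDSV.holderCZBound_holds`, and the rearrangement
`rieszHessian_convect_sub_convect_rieszHessian_eq`. [cite: BuckmasterEtAl2018, App. D Prop. D.1] -/
theorem commutator_rieszHessian_zero_le {α : ℝ≥0} (hα0 : 0 < α) (hα1 : α < 1) :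
    ∃ C : ℝ≥0, ∀ (i j : Fin 3) (b : UnitAddTorus (Fin 3) → EuclideanSpace ℝ (Fin 3))
      (f : UnitAddTorus (Fin 3) → ℝ), IsSmooth b → IsSmooth f →
      Torus.eContDiffHolderNorm 0 α
          (fun x => rieszHessian i j (Torus.convect b f) x - Torus.convect b (rieszHessian i j f) x) ≤
        C * (Torus.eContDiffHolderNorm 1 α b * Torus.eContDiffHolderNorm 0 α f) := by
  have hα0' : (0 : ℝ) < α := by exact_mod_cast hα0
  have hα1' : (α : ℝ) < 1 := by exact_mod_cast hα1
  obtain ⟨K, hK0, hK⟩ := TorusHeat.exists_commutator_holder_bound (F := ℝ) (Fin 3) hα0' hα1'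
  obtain ⟨C₀, hC₀⟩ := holderCZBound_holds α hα0 hα1
  have hC₀0 : (0 : ℝ) ≤ C₀ := C₀.2
  -- the constant
  set Cr : ℝ := 2 * K * (1 + 4 * C₀) with hCr
  have hCr0 : 0 ≤ Cr := by positivity
  obtain ⟨Cn, hCn⟩ : ∃ Cn : ℝ≥0, (Cn : ℝ) = Cr + 1 := ⟨⟨Cr + 1, by positivity⟩, rfl⟩
  refine ⟨Cn, fun i j b f hb hf => ?_⟩
  -- finiteness and the real sizes `𝔟 = ‖b‖_{1,α}`, `𝔣 = ‖f‖_{0,α}`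
  have hbfin : Torus.eContDiffHolderNorm 1 α b < ⊤ := hb.eContDiffHolderNorm_lt_top 1 hα1.le
  have hffin : Torus.eContDiffHolderNorm 0 α f < ⊤ := hf.eContDiffHolderNorm_lt_top 0 hα1.le
  set 𝔟 : ℝ := (Torus.eContDiffHolderNorm 1 α b).toReal with h𝔟_def
  set 𝔣 : ℝ := (Torus.eContDiffHolderNorm 0 α f).toReal with h𝔣_def
  have h𝔟0 : 0 ≤ 𝔟 := ENNReal.toReal_nonneg
  have h𝔣0 : 0 ≤ 𝔣 := ENNReal.toReal_nonneg
  have h𝔟eq : ENNReal.ofReal 𝔟 = Torus.eContDiffHolderNorm 1 α b := ENNReal.ofReal_toReal hbfin.ne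
  have h𝔣eq : ENNReal.ofReal 𝔣 = Torus.eContDiffHolderNorm 0 α f := ENNReal.ofReal_toReal hffin.ne
  -- components of `b`
  set bk : Fin 3 → UnitAddTorus (Fin 3) → ℝ := fun k y => b y k with hbk_def
  have hbk : ∀ k, IsSmooth (bk k) := fun k => hb.apply k
  have hbk1 : ∀ k, Torus.eContDiffHolderNorm 1 α (bk k) ≤ ENNReal.ofReal 𝔟 := fun k => by
    rw [h𝔟eq]; exact eContDiffHolderNorm_coord_le hb 1 α k
  have hone : ∀ k, Torus.eContDiffHolderNorm 1 α (bk k) =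
      eSupNorm (lift (bk k)) + eSupNorm (fderiv ℝ (lift (bk k))) + eHolderNorm α (fderiv ℝ (lift (bk k))) := by
    intro k
    rw [Torus.eContDiffHolderNorm, eContDiffHolderNorm_one_eq, eSupNorm_iteratedFDeriv_succ_eq_fderiv,
      eSupNorm_iteratedFDeriv_zero, eHolderNorm_iteratedFDeriv_succ_eq_fderiv, eHolderNorm_iteratedFDeriv_zero]
  have hCb : ∀ k z, ‖bk k z‖ ≤ 𝔟 := fun k z =>
    TorusHeat.norm_le_of_eSupNorm_le h𝔟0 ((Torus.eSupNorm_le_eContDiffHolderNorm 1 α (bk k)).trans (hbk1 k)) z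
  have hL : ∀ k y, ‖fderiv ℝ (lift (bk k)) y‖ ≤ 𝔟 := fun k y => by
    refine TorusHeat.norm_le_of_eSupNorm_le h𝔟0 (le_trans ?_ (hbk1 k)) y
    rw [hone k]
    exact le_add_self.trans le_self_add
  have hH : ∀ k a a', ‖fderiv ℝ (lift (bk k)) a - fderiv ℝ (lift (bk k)) a'‖ ≤ 𝔟 * ‖a - a'‖ ^ (α : ℝ) :=
    fun k a a' => by
    refine TorusHeat.norm_sub_le_of_eHolderNorm_le h𝔟0 (le_trans ?_ (hbk1 k)) a a'
    rw [hone k]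
    exact le_add_self
  -- the sizes of `f`
  have hzero : Torus.eContDiffHolderNorm 0 α f = eSupNorm (lift f) + eHolderNorm α (lift f) := by
    rw [Torus.eContDiffHolderNorm, eContDiffHolderNorm_zero_eq]
  have hM : ∀ z, ‖f z‖ ≤ 𝔣 := fun z =>
    TorusHeat.norm_le_of_eSupNorm_le h𝔣0 ((Torus.eSupNorm_le_eContDiffHolderNorm 0 α f).trans h𝔣eq.ge) z
  have hA : ∀ y z, ‖lift f y - lift f z‖ ≤ 𝔣 * ‖y - z‖ ^ (α : ℝ) := fun y z => by
    refine TorusHeat.norm_sub_le_of_eHolderNorm_le h𝔣0 (le_trans ?_ h𝔣eq.ge) y z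
    rw [hzero]
    exact le_add_self
  -- the data `U = Tf`, `Wₖ = T(bₖ f)`, `W₀ = T((div b) f)`
  have hbf : ∀ k, IsSmooth (fun w => bk k w • f w) := fun k => (hbk k).smul' hf
  have hdv : IsSmooth (fun w => ∑ k, Torus.partialDeriv k (bk k) w) :=
    Torus.isSmooth_finset_sum _ fun k _ => (hbk k).partialDeriv k
  have hh : IsSmooth (fun w => (∑ k, Torus.partialDeriv k (bk k) w) • f w) := hdv.smul' hf
  set U : UnitAddTorus (Fin 3) → ℝ := rieszHessian i j f with hU_def
  set W : Fin 3 → UnitAddTorus (Fin 3) → ℝ := fun k => rieszHessian i j (fun w => bk k w • f w) with hW_def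
  set W₀ : UnitAddTorus (Fin 3) → ℝ := rieszHessian i j (fun w => (∑ k, Torus.partialDeriv k (bk k) w) • f w) with hW₀_def
  have hU : IsSmooth U := isSmooth_rieszHessian hf i j
  have hW : ∀ k, IsSmooth (W k) := fun k => isSmooth_rieszHessian (hbf k) i j
  have hW₀ : IsSmooth W₀ := isSmooth_rieszHessian hh i j
  have hΔU : ∀ k z, Torus.laplacian (Torus.partialDeriv k U) z = Torus.partialDeriv i (Torus.partialDeriv j (Torus.partialDeriv k f)) z := by
    intro k z
    rw [hU_def, partialDeriv_rieszHessian hf]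
    exact laplacian_rieszHessian (hf.partialDeriv k) i j z
  have hΔW : ∀ k z, Torus.laplacian (Torus.partialDeriv k (W k)) z =
      Torus.partialDeriv i (Torus.partialDeriv j (Torus.partialDeriv k (fun w => bk k w • f w))) z := by
    intro k z
    rw [hW_def]
    dsimp only
    rw [partialDeriv_rieszHessian (hbf k)]
    exact laplacian_rieszHessian ((hbf k).partialDeriv k) i j z
  have hΔW₀ : ∀ z, Torus.laplacian W₀ z =
      Torus.partialDeriv i (Torus.partialDeriv j (fun w => (∑ k, Torus.partialDeriv k (bk k) w) • f w)) z := fun z =>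
    laplacian_rieszHessian hh i j z
  -- sup bounds through `BDSV.holderCZBound_holds`
  have hsupT : ∀ {g : UnitAddTorus (Fin 3) → ℝ} (hg : IsSmooth g) {M : ℝ} (hM0 : 0 ≤ M)
      (hgM : Torus.eContDiffHolderNorm 0 α g ≤ ENNReal.ofReal M) (z : UnitAddTorus (Fin 3)),
      ‖rieszHessian i j g z‖ ≤ C₀ * M := by
    intro g hg M hM0 hgM z
    refine TorusHeat.norm_le_of_eSupNorm_le (by positivity) ?_ z
    calc eSupNorm (rieszHessian i j g) ≤ Torus.eContDiffHolderNorm 0 α (rieszHessian i j g) :=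
          Torus.eSupNorm_le_eContDiffHolderNorm 0 α _
      _ ≤ C₀ * Torus.eContDiffHolderNorm 0 α g := hC₀ i j g hg
      _ ≤ C₀ * ENNReal.ofReal M := mul_le_mul' le_rfl hgM
      _ = ENNReal.ofReal (C₀ * M) := by
          rw [ENNReal.ofReal_mul hC₀0, ENNReal.ofReal_coe_nnreal]
  have hBU : ∀ z, ‖U z‖ ≤ C₀ * 𝔣 := fun z => hsupT hf h𝔣0 h𝔣eq.ge z
  -- `‖bₖ f‖_{0,α} ≤ 3 𝔟 𝔣` and `‖(div b) f‖_{0,α} ≤ 3 𝔟 𝔣`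
  set Bm : ℝ →L[ℝ] ℝ →L[ℝ] ℝ := ContinuousLinearMap.mul ℝ ℝ with hBm
  have hBm1 : ‖Bm‖ₑ ≤ 1 := by
    rw [← ofReal_norm, ← ENNReal.ofReal_one]
    rw [hBm]
    exact ENNReal.ofReal_le_ofReal (ContinuousLinearMap.opNorm_mul_le ℝ ℝ)
  have hprod : ∀ {θ : UnitAddTorus (Fin 3) → ℝ} (hθ : IsSmooth θ),
      Torus.eContDiffHolderNorm 0 α (fun w => θ w • f w) ≤
        Torus.eContDiffHolderNorm 0 α θ * Torus.eContDiffHolderNorm 0 α f := by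
    intro θ hθ
    have h := Torus.eContDiffHolderNorm_bilinear_le Bm (hθ.isContDiff (n := 0) (by simp))
      (hf.isContDiff (n := 0) (by simp)) α
    have hfun : (fun x => Bm (θ x) (f x)) = fun w => θ w • f w := by
      funext w; simp [hBm, smul_eq_mul]
    rw [hfun] at h
    refine h.trans ?_
    simp only [zero_add, pow_zero, one_mul, Finset.sum_range_one, Nat.sub_zero]
    calc ‖Bm‖ₑ * (Torus.eContDiffHolderNorm 0 α θ * Torus.eContDiffHolderNorm 0 α f)
        ≤ 1 * (Torus.eContDiffHolderNorm 0 α θ * Torus.eContDiffHolderNorm 0 α f) := mul_le_mul' hBm1 le_rfl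
      _ = _ := one_mul _
  have h3 : ∀ k, Torus.eContDiffHolderNorm 0 α (fun w => bk k w • f w) ≤ ENNReal.ofReal (3 * 𝔟 * 𝔣) := by
    intro k
    refine (hprod (hbk k)).trans ?_
    have h1 : Torus.eContDiffHolderNorm 0 α (bk k) ≤ 3 * ENNReal.ofReal 𝔟 :=
      (Torus.eContDiffHolderNorm_le_three_mul_succ ((hbk k).isContDiff (n := (0 + 1 : ℕ)) (by simp)) hα1.le α).trans
        (mul_le_mul' le_rfl (hbk1 k))
    calc Torus.eContDiffHolderNorm 0 α (bk k) * Torus.eContDiffHolderNorm 0 α f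
        ≤ (3 * ENNReal.ofReal 𝔟) * ENNReal.ofReal 𝔣 := mul_le_mul' h1 h𝔣eq.ge
      _ = ENNReal.ofReal (3 * 𝔟 * 𝔣) := by
          rw [ENNReal.ofReal_mul (by positivity), ENNReal.ofReal_mul (by norm_num), ENNReal.ofReal_ofNat]
  have hdv3 : Torus.eContDiffHolderNorm 0 α (fun w => ∑ k, Torus.partialDeriv k (bk k) w) ≤ 3 * ENNReal.ofReal 𝔟 := by
    have hfun : (fun w => ∑ k, Torus.partialDeriv k (bk k) w) = ∑ k, Torus.partialDeriv k (bk k) := by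
      funext w; simp only [Finset.sum_apply]
    rw [hfun]
    refine (Torus.eContDiffHolderNorm_sum_le Finset.univ fun k _ =>
      ((hbk k).partialDeriv k).isContDiff (n := 0) (by simp)).trans ?_
    calc ∑ k, Torus.eContDiffHolderNorm 0 α (Torus.partialDeriv k (bk k))
        ≤ ∑ _k : Fin 3, ENNReal.ofReal 𝔟 := Finset.sum_le_sum fun k _ =>
          (Torus.eContDiffHolderNorm_partialDeriv_le ((hbk k).isContDiff (n := (0 + 1 : ℕ)) (by simp)) k α).trans
            (hbk1 k)
      _ = 3 * ENNReal.ofReal 𝔟 := by simp [Finset.sum_const, Finset.card_univ, Fintype.card_fin, nsmul_eq_mul]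
  have h30 : Torus.eContDiffHolderNorm 0 α (fun w => (∑ k, Torus.partialDeriv k (bk k) w) • f w) ≤
      ENNReal.ofReal (3 * 𝔟 * 𝔣) := by
    refine (hprod hdv).trans ?_
    calc Torus.eContDiffHolderNorm 0 α (fun w => ∑ k, Torus.partialDeriv k (bk k) w) * Torus.eContDiffHolderNorm 0 α f
        ≤ (3 * ENNReal.ofReal 𝔟) * ENNReal.ofReal 𝔣 := mul_le_mul' hdv3 h𝔣eq.ge
      _ = ENNReal.ofReal (3 * 𝔟 * 𝔣) := by
          rw [ENNReal.ofReal_mul (by positivity), ENNReal.ofReal_mul (by norm_num), ENNReal.ofReal_ofNat]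
  have h3𝔟𝔣 : 0 ≤ 3 * 𝔟 * 𝔣 := by positivity
  have hBW : ∀ k z, ‖W k z‖ ≤ C₀ * (3 * 𝔟 * 𝔣) := fun k z => hsupT (hbf k) h3𝔟𝔣 (h3 k) z
  have hBW₀ : ∀ z, ‖W₀ z‖ ≤ C₀ * (3 * 𝔟 * 𝔣) := fun z => hsupT hh h3𝔟𝔣 h30 z
  -- the abstract estimate
  obtain ⟨h1, h2⟩ := hK (b := bk) hbk hf hU hW₀ hW i j hΔU hΔW hΔW₀ hCb hL hH hM hA hBU hBW hBW₀
  -- identification of the commutator with `g`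
  have hg : (fun x => rieszHessian i j (Torus.convect b f) x - Torus.convect b (rieszHessian i j f) x) =
      fun z => (∑ k, Torus.partialDeriv k (W k) z) - W₀ z - ∑ k, bk k z • Torus.partialDeriv k U z :=
    rieszHessian_convect_sub_convect_rieszHessian_eq hb hf i j
  rw [hg]
  -- the size `Q` and the conversion to the extended norm
  set Q : ℝ := 𝔟 * 𝔣 + C₀ * (3 * 𝔟 * 𝔣) + 𝔟 * (C₀ * 𝔣) with hQ
  have hQ0 : 0 ≤ Q := by positivity
  have hKQ : 0 ≤ K * Q := by positivity
  have hQeq : K * Q + K * Q = Cr * (𝔟 * 𝔣) := by rw [hQ, hCr]; ring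
  set G : EuclideanSpace ℝ (Fin 3) → ℝ := lift (fun z => (∑ k, Torus.partialDeriv k (W k) z) - W₀ z -
    ∑ k, bk k z • Torus.partialDeriv k U z) with hG
  have hGsup : eSupNorm G ≤ ENNReal.ofReal (K * Q) := eSupNorm_le_ofReal h1
  have hGhol : eHolderNorm α G ≤ ENNReal.ofReal (K * Q) := by
    have := (holderWith_of_norm_sub_le hKQ h2).eHolderNorm_le
    rwa [show ((((K * Q).toNNReal : ℝ≥0)) : ℝ≥0∞) = ENNReal.ofReal (K * Q) from rfl] at this
  unfold Torus.eContDiffHolderNorm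
  rw [eContDiffHolderNorm_zero_eq]
  calc eSupNorm G + eHolderNorm α G ≤ ENNReal.ofReal (K * Q) + ENNReal.ofReal (K * Q) := add_le_add hGsup hGhol
    _ = ENNReal.ofReal (Cr * (𝔟 * 𝔣)) := by rw [← ENNReal.ofReal_add hKQ hKQ, hQeq]
    _ = ENNReal.ofReal Cr * (Torus.eContDiffHolderNorm 1 α b * Torus.eContDiffHolderNorm 0 α f) := by
        rw [ENNReal.ofReal_mul hCr0, ENNReal.ofReal_mul h𝔟0, h𝔟eq, h𝔣eq]
    _ ≤ (Cn : ℝ≥0∞) * (Torus.eContDiffHolderNorm 1 α b * Torus.eContDiffHolderNorm 0 α f) := by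
        gcongr
        rw [← ENNReal.ofReal_coe_nnreal, hCn]
        exact ENNReal.ofReal_le_ofReal (by linarith)

end BDSV

end Literature.Analysis.FluidPDE
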